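import Literature.NumberTheory.LFunctions.ChainCheck
import Literature.NumberTheory.LFunctions.RobinNumerical
import Literature.NumberTheory.LFunctions.RobinAnalyticSharp
import HarnessLib

/-!
# Soundness of the colossally abundant chain checker (plan N1 of provefact `Literature.NumberTheory.LFunctions.robin_iff`)

Topic: `Literature/NumberTheory/LFunctions`. The semantic soundness of the computable chain checker
`ChainCheck.lean`: if a chunk of the run succeeds, `runD T X U fuel d = some d'`, then the
**invariant** `Inv T X d` of the compact state is transported to `d'` (`runD_sound`); the initial
state `initD` (`N₀ = 55440`) satisfies the invariant (`initD_inv`); and a finished run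
(`ThX = some v`, `Llo ≥ v + U`) yields `robinCA_below X` (`robinCA_below_of_inv`), given the size
bound `log N ≤ θ(P) + U/2⁸⁰` for colossally abundant `N` with primes `< X`. The kernel facts (the
table, its completeness, the chunks of the run) and the assembly are in `ChainTable.lean`,
`ChainTableFacts.lean`, `ChainRun*.lean`, `RobinCABelow.lean`. Nothing is asserted here: the
`def`s are the semantic quantities of a state (below) and two bookkeeping predicates.

## Semantics of a state

For a table `T` (hypotheses `TableOK T tmax`: strictly increasing, entries in `[2, tmax]`, head
`2`, and *complete* — every prime `≤ tmax` is an entry) and thresholds `xs = [x₁, …, x_K]`: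
`expo xs q = #{j : q ≤ x_j}` is the exponent of the entry `q`, `Nnat T xs = ∏_{q ∈ T} q^{expo q}` the
number of the state, `Lreal = ∑ expo q · log q = log N`, `Sreal = ∑ (log σ_{expo q}(q) − expo q ·
log q) = log(σ(N)/N)` (`gsum_eq_sigma`), `ThT T x = ∑_{q ∈ T, q ≤ x} log q ≥ θ(x)` (`theta_le_ThT`,
by completeness). The ratio of a candidate, `ratioF ε c j = σ_j(c)/(c^{1+ε} σ_{j−1}(c))`
(`Envelope.lean`), is what the cached level data enclose: `Level.Valid` (Part 2) records
`Blo ≤ 2⁸⁰ log c ≤ Bhi`, `Alo ≤ 2⁸⁰ A ≤ Ahi` with `A = log(1 + 1/(c σ_{j−1}(c)))`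
(`= log ratioF 0 c j`, `log_ratioF_eq`), whence `need ≤ e ⇒ ratioF (e/2⁸⁰) c j ≤ 1`
(`Valid.ratioF_le_one`) and `e ≤ ecrit ⇒ 1 ≤ ratioF (e/2⁸⁰) c j` (`Valid.one_le_ratioF`);
`mkLevelB/Full/Next_valid` establish validity from `lnp_sound`/`logN_sound`.

## The argument

* **Envelope** (Part 5, `envelope`; Alaoglu–Erdős 1944, §3): if the thresholds are non-increasing,
  every threshold entered its level with ratio `≥ 1` (`CondUp`, the invariant) and every level's
  candidate — the table successor of its threshold, including the virtual level `K+1` of threshold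
  `1` and the tail candidate above `x₁` — has ratio `≤ 1` (`CondDown`, checked by `step` on the
  **new** state through `need ≤ e`), then `σ(m)/m^{1+ε} ≤ exp(S − εL)` for **all** `m ≥ 1`:
  prime by prime (`Envelope.sigmaRpow_le_prod`), the factor of a prime `q` with exponent `b` is
  compared with its value at `a = expo q` by telescoping the ratios (`sum_log_ratioF`,
  `ratioF_anti_index`, antitonicity in `q` between consecutive thresholds `ratioF_antitone`, and in
  `ε`); primes `q > x₁` have exponent `0` and a factor `≤ 1` (their ratio at exponent `0` is at
  most the tail candidate's, `succT_le_of_prime`); composite table entries only add non-negative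
  terms (`CondUp` telescoped), so no primality of entries is needed, while completeness of `T` is
  what makes "table successor" bound the next *prime*. No maximiser property of the *initial* state
  is used: `initD` only certifies `CondUp` at `N₀ = 55440` (`upOK_sound`), and the envelope of the
  first step — like every step — is anchored at the new state, whose `CondDown` the step checks.
* **Robin on a step interval** (Part 6, `robin_of_envelope`; Robin 1984, §3 Prop. 1): with
  `M = exp(S' − εL')` the envelope at the new state `N'`, the two endpoint inequalities
  `log M + ε log N' < γ + log log log N'` and `log M + ε log N < γ + log log log N` give Robin's
  inequality on `[N, N']` by concavity of `u ↦ log log u − εu` (`RobinCriterion`).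
* **Checks** (Part 7): `robinChk_sound` turns the scaled comparisons of `robinChk` (with
  `GAMMALO ≤ 2⁸⁰γ`, the lazily refreshed `lll ≤ 2⁸⁰ log log log N` from `lllLoN_sound`, and
  `mulLo e Blo ≤ 2⁸⁰ ε log c`) into those two inequalities; `argmax_spec`, `need_le_maxima`,
  `stepAt_spec` describe the list manipulations of the cold path.
* **Invariant and step** (Parts 8–9): `Inv T X d` = thresholds non-increasing and `≥ 2`, level `1`
  has a candidate, `0 < e`, `CondUp xs (e/2⁸⁰)`, the enclosures `Llo ≤ 2⁸⁰ log N`,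
  `2⁸⁰ log(σN/N) ≤ Shi`, `lll ≤ 2⁸⁰ log log log N`, `2⁸⁰ Θ_T(x₁) ≤ T1hi`, the frozen
  `ThX = some v ⇒ 2⁸⁰ θ(p) ≤ v` for primes `p < X`, `N ≥ 55440`, and **Robin's inequality for
  `5040 < n ≤ N`**. `step_core` is the semantic step (new threshold, `ε' ≤ ε` keeps `CondUp` by
  `ratioF_antitone_eps`, the new `CondDown` from the checks, envelope + `robin_of_envelope` extend
  Robin to `n ≤ N'`, `T1hi`/`ThX` bookkeeping by `theta_le_ThT`); `WF` (validity of the expanded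
  state's cached levels and cursors `rest = after x T`) is preserved by `step` (`step_sound`, hot and
  cold paths) and established by `expand` (`expand_spec`, `mkLevels_spec`); `run_sound`,
  `runD_sound` iterate. `initD_inv`: `N₀ = 55440 = 2⁴·3²·5·7·11`, `σ(N₀) = 232128`, thresholds
  `11, 3, 2, 2`, Robin for `5040 < n ≤ 55440` from `RobinNumerical.robinInequality_le_55440`.
* **Conclusion** (`robinCA_below_of_inv`): a colossally abundant `N > 5040` with primes `< X` has
  `log N ≤ θ(P) + U/2⁸⁰ ≤ (v + U)/2⁸⁰ ≤ Llo/2⁸⁰ ≤ log N_final`, so `N ≤ N_final` and the invariant's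
  Robin clause applies.

## References

* L. Alaoglu, P. Erdős, *On highly composite and similar numbers*, Trans. AMS 56 (1944), 448–469,
  §3 (maximisers of `σ(n)/n^{1+ε}`). [AlaogluErdos1944]
* G. Robin, *Grandes valeurs de la fonction somme des diviseurs et hypothèse de Riemann*, J. Math.
  Pures Appl. 63 (1984), 187–213, §3 Prop. 1 (interpolation between consecutive colossally abundant
  numbers). [Robin1984]
-/

namespace Literature.NumberTheory.LFunctions.ChainCheck

open Finset Envelope

/-! ## Part 2: levels and the ratio tests -/

section LevelSound

/-- `A(c, j) = log(1 + 1/(c σ_{j-1}(c)))` (`= log σ_j(c) − log σ_{j−1}(c) − log c`). [folklore] -/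
noncomputable def Areal (c j : ℕ) : ℝ := Real.log (1 + 1 / ((c : ℝ) * gsum c (j - 1)))

/-- The candidate of a level (head of its cursor; `0` if the cursor is empty). [folklore] -/
def Level.cand (L : Level) : ℕ := L.rest.headD 0

/-- Validity of the cached data of a level. [folklore] -/
structure Level.Valid (L : Level) : Prop where
  /-- the cursor is not exhausted -/
  hne : L.rest ≠ []
  /-- the candidate is at least `2` -/
  hc2 : 2 ≤ L.cand
  /-- the index is at least `1` -/
  hj : 1 ≤ L.j
  /-- `Blo ≤ 2⁸⁰ log c` -/
  hBlo : (L.Blo : ℝ) ≤ 2 ^ 80 * Real.log L.cand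
  /-- `2⁸⁰ log c ≤ Bhi` -/
  hBhi : 2 ^ 80 * Real.log L.cand ≤ L.Bhi
  /-- `0 < Blo` -/
  hBlo0 : 0 < L.Blo
  /-- `Alo ≤ 2⁸⁰ A` -/
  hAlo : (L.Alo : ℝ) ≤ 2 ^ 80 * Areal L.cand L.j
  /-- `2⁸⁰ A ≤ Ahi` -/
  hAhi : 2 ^ 80 * Areal L.cand L.j ≤ L.Ahi
  /-- `ecrit = ⌊Alo 2⁸⁰/Bhi⌋` -/
  hecrit : L.ecrit = L.Alo * SC / L.Bhi
  /-- `need = ⌈Ahi 2⁸⁰/Blo⌉` -/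
  hneed : L.need = (L.Ahi * SC + L.Blo - 1) / L.Blo

/-- **Validity of `mkLevelB`.** [folklore] -/
theorem mkLevelB_valid {j x c Blo Bhi : ℕ} {r : List ℕ} {L : Level} (hc : 2 ≤ c) (hj : 1 ≤ j)
    (hB1 : (Blo : ℝ) ≤ 2 ^ 80 * Real.log c) (hB2 : 2 ^ 80 * Real.log c ≤ Bhi)
    (h : mkLevelB j x (c :: r) Blo Bhi = some L) :
    L.Valid ∧ L.j = j ∧ L.x = x ∧ L.rest = c :: r := by
  unfold mkLevelB at h
  simp only [Nat.mul_eq, Nat.sub_eq, Nat.add_eq, natdiv_eq] at h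
  set q : ℕ := c * gsum c (j - 1) with hq
  cases hguard : (Nat.blt q 2 || Nat.beq Blo 0) with
  | true => rw [hguard] at h; simp at h
  | false =>
    rw [hguard] at h
    simp only [cond_false, Option.some.injEq] at h
    simp only [Bool.or_eq_false_iff] at hguard
    obtain ⟨hq2, hBlo0⟩ := hguard
    have hq2' : ¬ q < 2 := by
      intro hh
      have : Nat.blt q 2 = true := by simpa [Nat.blt_eq] using hh
      rw [this] at hq2; exact absurd hq2 (by decide)
    have hBlo0' : Blo ≠ 0 := fun hh => by simp [hh] at hBlo0
    have hqpos : 0 < q := by omega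
    obtain ⟨hA1, hA2⟩ := lnp_sound (p := 1) hqpos (by omega)
    have hAreal : Real.log (1 + ((1 : ℕ) : ℝ) / q) = Areal c j := by
      unfold Areal; rw [hq]; push_cast; ring_nf
    rw [hAreal] at hA1 hA2
    subst h
    exact ⟨⟨List.cons_ne_nil c r, hc, hj, hB1, hB2, Nat.pos_of_ne_zero hBlo0', hA1, hA2, rfl, rfl⟩,
      rfl, rfl, rfl⟩

/-- **Validity of `mkLevelFull`.** [folklore] -/
theorem mkLevelFull_valid {j x c : ℕ} {r : List ℕ} {L : Level} (hc : 2 ≤ c) (hj : 1 ≤ j)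
    (h : mkLevelFull j x (c :: r) = some L) :
    L.Valid ∧ L.j = j ∧ L.x = x ∧ L.rest = c :: r := by
  unfold mkLevelFull at h
  simp only at h
  rcases hl : logN c with _ | ⟨blo, bhi⟩
  · rw [hl] at h; simp at h
  · rw [hl] at h
    simp only at h
    obtain ⟨h1, h2, -⟩ := logN_sound hl
    exact mkLevelB_valid hc hj h1 h2 h

/-- **Validity of `mkLevelNext`** (the incremental logarithm). [folklore] -/
theorem mkLevelNext_valid {L L' : Level} (hV : L.Valid) {c c' : ℕ} {t : List ℕ}
    (hr : L.rest = c :: c' :: t) (hc' : 2 ≤ c') (h : mkLevelNext L = some L') :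
    L'.Valid ∧ L'.j = L.j ∧ L'.x = c ∧ L'.rest = c' :: t := by
  have hc : 2 ≤ c := by have := hV.hc2; simpa [Level.cand, hr] using this
  obtain ⟨Lj, Lx, Lrest, LBlo, LBhi, LAlo, LAhi, Lecrit, Lneed⟩ := L
  simp only at hr
  subst hr
  unfold mkLevelNext at h
  simp only [Nat.sub_eq, Nat.mul_eq, Nat.add_eq] at h
  cases hg : (Nat.ble (2 * (c' - c)) c && Nat.ble c c') with
  | false => rw [hg] at h; simp only [cond_false] at h; exact mkLevelFull_valid hc' hV.hj h
  | true =>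
    rw [hg] at h
    simp only [cond_true] at h
    simp only [Bool.and_eq_true, Nat.ble_eq] at hg
    obtain ⟨hd, hcc'⟩ := hg
    have hcpos : 0 < c := by omega
    obtain ⟨hD1, hD2⟩ := lnp_sound (p := c' - c) hcpos hd
    have hB1 := hV.hBlo
    have hB2 := hV.hBhi
    simp only [Level.cand, List.headD_cons] at hB1 hB2
    have hcR : (0 : ℝ) < c := by exact_mod_cast hcpos
    have hlog : Real.log c' = Real.log c + Real.log (1 + ((c' - c : ℕ) : ℝ) / c) := by
      rw [← Real.log_mul hcR.ne' (by positivity)]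
      congr 1
      rw [Nat.cast_sub hcc']
      field_simp
      ring
    refine mkLevelB_valid hc' hV.hj ?_ ?_ h
    · push_cast; rw [hlog]; linarith
    · push_cast; rw [hlog]; linarith

/-! ### The ratio of a level's candidate -/

/-- `ratioF ε c (j−1) = (1 + 1/(c σ_{j−1}(c))) c^{−ε}`; in logarithms `log ratioF = A − ε log c`.
[folklore] -/
theorem log_ratioF_eq (ε : ℝ) {c j : ℕ} (hc : 1 ≤ c) (hj : 1 ≤ j) :
    Real.log (ratioF ε c (j - 1)) = Areal c j - ε * Real.log c := by
  have hcR : (1 : ℝ) ≤ c := by exact_mod_cast hc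
  have hc0 : (0 : ℝ) < c := by linarith
  have hg0 : 0 < geomSum (c : ℝ) (j - 1) := lt_of_lt_of_le one_pos (one_le_geomSum hc0.le _)
  unfold ratioF Areal
  rw [gsum_eq_geomSum, show j - 1 + 1 = j by omega]
  set g : ℝ := geomSum (c : ℝ) (j - 1) with hg
  have hgs : geomSum (c : ℝ) j = c * g + 1 := by
    conv_lhs => rw [show j = j - 1 + 1 by omega]
    exact geomSum_succ _ _
  have e : geomSum (c : ℝ) j / (g * (c : ℝ) ^ (1 + ε)) = (1 + 1 / ((c : ℝ) * g)) * (c : ℝ) ^ (-ε) := by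
    rw [hgs, Real.rpow_add hc0, Real.rpow_one, Real.rpow_neg hc0.le]
    field_simp
  rw [e, Real.log_mul (by positivity) (by positivity), Real.log_rpow hc0]
  ring

/-- `ratioF > 0` at `c ≥ 1`. [folklore] -/
theorem ratioF_pos' (ε : ℝ) {c : ℝ} (hc : 1 ≤ c) (j : ℕ) : 0 < ratioF ε c j := by
  unfold ratioF
  have hc0 : 0 < c := by linarith
  have := one_le_geomSum hc0.le j
  have := one_le_geomSum hc0.le (j + 1)
  positivity

/-- **Ratio test from `need ≤ e`**: the candidate's ratio is `≤ 1` at `ε = e/2⁸⁰`. [folklore] -/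
theorem Level.Valid.ratioF_le_one {L : Level} (hV : L.Valid) {e : ℕ} (he : L.need ≤ e) :
    ratioF ((e : ℝ) / 2 ^ 80) L.cand (L.j - 1) ≤ 1 := by
  have hc1 : 1 ≤ L.cand := le_trans (by norm_num) hV.hc2
  have hcR : (1 : ℝ) ≤ L.cand := by exact_mod_cast hc1
  have hpos := ratioF_pos' ((e : ℝ) / 2 ^ 80) hcR (L.j - 1)
  rw [← Real.log_nonpos_iff hpos.le, log_ratioF_eq _ hc1 hV.hj]
  -- `Ahi · 2⁸⁰ ≤ e · Blo`
  have hN : L.Ahi * SC ≤ e * L.Blo := by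
    have h1 : (L.Ahi * SC + L.Blo - 1) / L.Blo ≤ e := by rw [← hV.hneed]; exact he
    have h2 : (L.Ahi * SC + L.Blo - 1) / L.Blo < e + 1 := by omega
    rw [Nat.div_lt_iff_lt_mul hV.hBlo0] at h2
    have hB := hV.hBlo0
    have : L.Ahi * SC + L.Blo - 1 < e * L.Blo + L.Blo := by linarith
    omega
  have hNR : (L.Ahi : ℝ) * 2 ^ 80 ≤ (e : ℝ) * L.Blo := by
    rw [← SC_real]; exact_mod_cast hN
  have h1 := hV.hAhi
  have h2 := hV.hBlo
  have he0 : (0 : ℝ) ≤ e := by positivity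
  have hlog0 : 0 ≤ Real.log (L.cand : ℝ) := Real.log_nonneg hcR
  -- `2⁸⁰ · 2⁸⁰ A ≤ Ahi 2⁸⁰ ≤ e Blo ≤ e 2⁸⁰ log c`
  have h3 : (e : ℝ) * L.Blo ≤ e * (2 ^ 80 * Real.log L.cand) := mul_le_mul_of_nonneg_left h2 he0
  have h4 : 2 ^ 80 * (2 ^ 80 * Areal L.cand L.j) ≤ (L.Ahi : ℝ) * 2 ^ 80 := by nlinarith
  have h5 : 2 ^ 80 * (2 ^ 80 * Areal L.cand L.j) ≤ 2 ^ 80 * (e * Real.log L.cand) := by nlinarith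
  have h6 : 2 ^ 80 * Areal L.cand L.j ≤ e * Real.log L.cand := le_of_mul_le_mul_left h5 (by positivity)
  have : Areal L.cand L.j ≤ (e : ℝ) / 2 ^ 80 * Real.log L.cand := by
    rw [div_mul_eq_mul_div, le_div_iff₀ (by positivity)]; linarith
  linarith

/-- **Ratio `≥ 1` from `e ≤ ecrit`** (and `0 < e`): the stepped candidate enters its level with
ratio `≥ 1` at the new `ε = e/2⁸⁰`. [folklore] -/
theorem Level.Valid.one_le_ratioF {L : Level} (hV : L.Valid) {e : ℕ} (he : e ≤ L.ecrit) :
    1 ≤ ratioF ((e : ℝ) / 2 ^ 80) L.cand (L.j - 1) := by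
  have hc1 : 1 ≤ L.cand := le_trans (by norm_num) hV.hc2
  have hcR : (1 : ℝ) ≤ L.cand := by exact_mod_cast hc1
  have hpos := ratioF_pos' ((e : ℝ) / 2 ^ 80) hcR (L.j - 1)
  rw [← Real.log_nonneg_iff hpos, log_ratioF_eq _ hc1 hV.hj]
  have hlogpos : 0 < Real.log (L.cand : ℝ) := Real.log_pos (by exact_mod_cast hV.hc2)
  have hBhi0R : (0 : ℝ) < L.Bhi := by
    have := hV.hBhi
    have : (0 : ℝ) < 2 ^ 80 * Real.log L.cand := by positivity
    linarith
  have hBhi0 : 0 < L.Bhi := by exact_mod_cast hBhi0R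
  -- `e · Bhi ≤ Alo · 2⁸⁰`
  have hN : e * L.Bhi ≤ L.Alo * SC := by
    have h1 : e ≤ L.Alo * SC / L.Bhi := by rw [← hV.hecrit]; exact he
    exact (Nat.le_div_iff_mul_le hBhi0).1 h1
  have hNR : (e : ℝ) * L.Bhi ≤ (L.Alo : ℝ) * 2 ^ 80 := by
    rw [← SC_real]; exact_mod_cast hN
  have h1 := hV.hAlo
  have h2 := hV.hBhi
  have he0 : (0 : ℝ) ≤ e := by positivity
  have h3 : (e : ℝ) * (2 ^ 80 * Real.log L.cand) ≤ e * L.Bhi := mul_le_mul_of_nonneg_left h2 he0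
  have h5 : 2 ^ 80 * (e * Real.log L.cand) ≤ 2 ^ 80 * (2 ^ 80 * Areal L.cand L.j) := by nlinarith
  have h6 : (e : ℝ) * Real.log L.cand ≤ 2 ^ 80 * Areal L.cand L.j := le_of_mul_le_mul_left h5 (by positivity)
  have : (e : ℝ) / 2 ^ 80 * Real.log L.cand ≤ Areal L.cand L.j := by
    rw [div_mul_eq_mul_div, div_le_iff₀ (by positivity)]; linarith
  linarith

/-! ### Monotonicity of the ratio in `ε` and in the exponent; telescoping -/

/-- `ratioF` is non-increasing in `ε` (`x ≥ 1`). [folklore] -/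
theorem ratioF_antitone_eps {ε ε' : ℝ} (h : ε' ≤ ε) {x : ℝ} (hx : 1 ≤ x) (j : ℕ) :
    ratioF ε x j ≤ ratioF ε' x j := by
  have hx0 : 0 < x := by linarith
  have e : ∀ t : ℝ, ratioF t x j = x ^ (-t) + (geomSum x j * x ^ (1 + t))⁻¹ := by
    intro t
    have hg : 0 < geomSum x j := lt_of_lt_of_le one_pos (one_le_geomSum hx0.le j)
    unfold ratioF
    rw [geomSum_succ, Real.rpow_add hx0, Real.rpow_one, Real.rpow_neg hx0.le]
    field_simp
  rw [e, e]
  have h1 : x ^ (-ε) ≤ x ^ (-ε') := Real.rpow_le_rpow_of_exponent_le hx (by linarith)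
  have hg : 0 < geomSum x j := lt_of_lt_of_le one_pos (one_le_geomSum hx0.le j)
  have h2 : (geomSum x j * x ^ (1 + ε))⁻¹ ≤ (geomSum x j * x ^ (1 + ε'))⁻¹ := by
    apply inv_anti₀ (by positivity)
    apply mul_le_mul_of_nonneg_left _ hg.le
    exact Real.rpow_le_rpow_of_exponent_le hx (by linarith)
  linarith

/-- `ratioF ε x (j+1) ≤ ratioF ε x j` (`x ≥ 1`). [folklore] -/
theorem ratioF_succ_le' (ε : ℝ) {x : ℝ} (hx : 1 ≤ x) (j : ℕ) :
    ratioF ε x (j + 1) ≤ ratioF ε x j := by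
  have hx0 : 0 < x := by linarith
  have e : ∀ k : ℕ, ratioF ε x k = x ^ (-ε) + (geomSum x k * x ^ (1 + ε))⁻¹ := by
    intro k
    have hg : 0 < geomSum x k := lt_of_lt_of_le one_pos (one_le_geomSum hx0.le k)
    unfold ratioF
    rw [geomSum_succ, Real.rpow_add hx0, Real.rpow_one, Real.rpow_neg hx0.le]
    field_simp
  rw [e, e]
  have hg : 0 < geomSum x j := lt_of_lt_of_le one_pos (one_le_geomSum hx0.le j)
  have hmono : geomSum x j ≤ geomSum x (j + 1) := by
    rw [geomSum_succ]
    nlinarith [one_le_geomSum hx0.le j]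
  have : (geomSum x (j + 1) * x ^ (1 + ε))⁻¹ ≤ (geomSum x j * x ^ (1 + ε))⁻¹ := by
    apply inv_anti₀ (by positivity)
    exact mul_le_mul_of_nonneg_right hmono (by positivity)
  linarith

/-- `ratioF ε x b ≤ ratioF ε x a` for `a ≤ b` (`x ≥ 1`). [folklore] -/
theorem ratioF_anti_index (ε : ℝ) {x : ℝ} (hx : 1 ≤ x) {a b : ℕ} (h : a ≤ b) :
    ratioF ε x b ≤ ratioF ε x a := by
  induction h with
  | refl => exact le_rfl
  | step _ ih => exact (ratioF_succ_le' ε hx _).trans ih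

/-- **Telescoping**: `∑_{b<a} log ratioF ε x b = log g_a(x) − a (1+ε) log x` (`x ≥ 1`). [folklore] -/
theorem sum_log_ratioF (ε : ℝ) {x : ℝ} (hx : 1 ≤ x) :
    ∀ a : ℕ, ∑ b ∈ range a, Real.log (ratioF ε x b) =
      Real.log (geomSum x a) - a * (1 + ε) * Real.log x
  | 0 => by simp [geomSum]
  | a + 1 => by
      have hx0 : 0 < x := by linarith
      rw [Finset.sum_range_succ, sum_log_ratioF ε hx a]
      have hg : 0 < geomSum x a := lt_of_lt_of_le one_pos (one_le_geomSum hx0.le a)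
      have hg1 : 0 < geomSum x (a + 1) := lt_of_lt_of_le one_pos (one_le_geomSum hx0.le _)
      unfold ratioF
      rw [Real.log_div hg1.ne' (by positivity), Real.log_mul hg.ne' (by positivity),
        Real.log_rpow hx0]
      push_cast
      ring

end LevelSound

/-! ## Part 3: the table and the cursors -/

section TableSound

/-- Hypotheses on the prime table `T` with bound `tmax`: strictly increasing, entries `≥ 2`,
starting with `2`, bounded by `tmax`, and **complete**: every prime `≤ tmax` is in `T`. [folklore] -/
structure TableOK (T : List ℕ) (tmax : ℕ) : Prop where
  /-- strictly increasing -/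
  sorted : T.Pairwise (· < ·)
  /-- entries are at least `2` -/
  two_le : ∀ q ∈ T, 2 ≤ q
  /-- the table starts with `2` -/
  head2 : T.head? = some 2
  /-- entries are at most `tmax` -/
  bounded : ∀ q ∈ T, q ≤ tmax
  /-- completeness -/
  complete : ∀ p : ℕ, p.Prime → p ≤ tmax → p ∈ T

variable {T : List ℕ}

/-- `after x T` on a cons. [folklore] -/
theorem after_cons (x q : ℕ) (t : List ℕ) :
    after x (q :: t) = if q ≤ x then after x t else q :: t := by
  unfold after
  rw [List.dropWhile_cons]
  by_cases h : q ≤ x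
  · simp [Nat.ble_eq, h]
  · have : Nat.ble q x = false := by
      cases hb : Nat.ble q x
      · rfl
      · exact absurd (Nat.le_of_ble_eq_true hb) h
    simp [this, h]

/-- For an increasing table, `after x T` consists of the entries `> x` (membership). [folklore] -/
theorem mem_after (hT : T.Pairwise (· < ·)) {x q : ℕ} : q ∈ after x T ↔ q ∈ T ∧ x < q := by
  induction T with
  | nil => simp [after]
  | cons a t ih =>
    rw [List.pairwise_cons] at hT
    rw [after_cons]
    by_cases h : a ≤ x
    · rw [if_pos h, ih hT.2]
      constructor
      · rintro ⟨h1, h2⟩; exact ⟨List.mem_cons_of_mem _ h1, h2⟩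
      · rintro ⟨h1, h2⟩
        rcases List.mem_cons.1 h1 with rfl | h1
        · omega
        · exact ⟨h1, h2⟩
    · rw [if_neg h]
      push Not at h
      constructor
      · intro hq
        refine ⟨hq, ?_⟩
        rcases List.mem_cons.1 hq with rfl | hq
        · exact h
        · exact h.trans (hT.1 q hq)
      · exact fun hq => hq.1

/-- `after x T` is a sublist (indeed a suffix) of `T`. [folklore] -/
theorem after_sublist (x : ℕ) (T : List ℕ) : (after x T).Sublist T := by
  induction T with
  | nil => simp [after]
  | cons a t ih =>
    rw [after_cons]
    split_ifs
    · exact ih.trans (List.sublist_cons_self a t)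
    · exact List.Sublist.refl _

/-- `after x T` is increasing. [folklore] -/
theorem after_pairwise (hT : T.Pairwise (· < ·)) (x : ℕ) : (after x T).Pairwise (· < ·) :=
  hT.sublist (after_sublist x T)

/-- `after x T = T` when every entry exceeds `x` (e.g. `x = 1`). [folklore] -/
theorem after_eq_self {x : ℕ} (h : ∀ q ∈ T, x < q) : after x T = T := by
  cases T with
  | nil => simp [after]
  | cons a t =>
    rw [after_cons, if_neg]
    have := h a (by simp); omega

/-- The head of a non-empty `after x T` is the least entry of `T` above `x`. [folklore] -/
theorem head_after (hT : T.Pairwise (· < ·)) {x c : ℕ} {r : List ℕ} (h : after x T = c :: r) :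
    c ∈ T ∧ x < c ∧ ∀ q ∈ T, x < q → c ≤ q := by
  have hc : c ∈ after x T := by rw [h]; simp
  obtain ⟨hcT, hxc⟩ := (mem_after hT).1 hc
  refine ⟨hcT, hxc, fun q hq hxq => ?_⟩
  have hq' : q ∈ after x T := (mem_after hT).2 ⟨hq, hxq⟩
  rw [h] at hq'
  rcases List.mem_cons.1 hq' with rfl | hq'
  · exact le_rfl
  · have hp := after_pairwise hT x
    rw [h, List.pairwise_cons] at hp
    exact (hp.1 q hq').le

/-- The tail of `after x T = c :: r` is `after c T`. [folklore] -/
theorem tail_after (hT : T.Pairwise (· < ·)) {x c : ℕ} {r : List ℕ} (h : after x T = c :: r) :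
    r = after c T := by
  induction T with
  | nil => simp [after] at h
  | cons a t ih =>
    rw [List.pairwise_cons] at hT
    rw [after_cons] at h
    by_cases hax : a ≤ x
    · rw [if_pos hax] at h
      have hr := ih hT.2 h
      rw [after_cons, if_pos]
      · exact hr
      · obtain ⟨-, hxc, -⟩ := head_after hT.2 h
        omega
    · rw [if_neg hax] at h
      simp only [List.cons.injEq] at h
      obtain ⟨rfl, rfl⟩ := h
      rw [after_cons, if_pos le_rfl]
      exact (after_eq_self hT.1).symm

/-- `after x T` is non-empty as soon as some entry exceeds `x`. [folklore] -/
theorem after_ne_nil (hT : T.Pairwise (· < ·)) {x q : ℕ} (hq : q ∈ T) (hxq : x < q) :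
    after x T ≠ [] := by
  intro h
  have : q ∈ after x T := (mem_after hT).2 ⟨hq, hxq⟩
  rw [h] at this; simp at this

/-- Monotonicity: `after x T ≠ []` and `y ≤ x` give `after y T ≠ []`. [folklore] -/
theorem after_ne_nil_of_le (hT : T.Pairwise (· < ·)) {x y : ℕ} (hxy : y ≤ x) (h : after x T ≠ []) :
    after y T ≠ [] := by
  obtain ⟨c, r, hc⟩ := List.exists_cons_of_ne_nil h
  obtain ⟨hcT, hxc, -⟩ := head_after hT hc
  exact after_ne_nil hT hcT (lt_of_le_of_lt hxy hxc)

/-- The successor of `x` in the table (`0` if none). [folklore] -/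
def succT (T : List ℕ) (x : ℕ) : ℕ := (after x T).headD 0

/-- Specification of `succT`. [folklore] -/
theorem succT_spec (hT : T.Pairwise (· < ·)) {x : ℕ} (h : after x T ≠ []) :
    succT T x ∈ T ∧ x < succT T x ∧ ∀ q ∈ T, x < q → succT T x ≤ q := by
  obtain ⟨c, r, hc⟩ := List.exists_cons_of_ne_nil h
  have : succT T x = c := by simp [succT, hc]
  rw [this]
  exact head_after hT hc

/-- `2 ∈ T`. [folklore] -/
theorem TableOK.two_mem {tmax : ℕ} (hT : TableOK T tmax) : 2 ∈ T :=
  List.mem_of_mem_head? (Option.mem_def.2 hT.head2)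

/-- There is no prime strictly between `x` and `succT T x` (completeness). [folklore] -/
theorem succT_le_of_prime {tmax : ℕ} (hT : TableOK T tmax) {x p : ℕ} (h : after x T ≠ [])
    (hp : p.Prime) (hxp : x < p) : succT T x ≤ p := by
  obtain ⟨hcT, -, hmin⟩ := succT_spec hT.sorted h
  by_cases hpt : p ≤ tmax
  · exact hmin p (hT.complete p hp hpt) hxp
  · push Not at hpt
    exact ((hT.bounded _ hcT).trans hpt.le)

end TableSound

/-! ## Part 4: semantics of the thresholds -/

section Semantics

variable {T : List ℕ}

/-- The exponent of `q`: the number of thresholds `≥ q`. [folklore] -/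
def expo (xs : List ℕ) (q : ℕ) : ℕ := (xs.filter (fun x => q ≤ x)).length

/-- No thresholds: exponent `0`. [folklore] -/
theorem expo_nil (q : ℕ) : expo [] q = 0 := rfl

/-- `expo` of a cons: the head threshold contributes `1` iff `q ≤ x`. [folklore] -/
theorem expo_cons (x : ℕ) (xs : List ℕ) (q : ℕ) :
    expo (x :: xs) q = (if q ≤ x then 1 else 0) + expo xs q := by
  unfold expo
  rw [List.filter_cons]
  by_cases h : q ≤ x
  · simp [h]; omega
  · simp [h]

/-- `expo` after appending a threshold. [folklore] -/
theorem expo_append_singleton (xs : List ℕ) (y q : ℕ) :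
    expo (xs ++ [y]) q = expo xs q + (if q ≤ y then 1 else 0) := by
  unfold expo
  rw [List.filter_append, List.length_append]
  by_cases h : q ≤ y <;> simp [h]

/-- `expo xs q ≤ xs.length`. [folklore] -/
theorem expo_le_length (xs : List ℕ) (q : ℕ) : expo xs q ≤ xs.length :=
  List.length_filter_le _ _

/-- Changing one threshold: `expo (xs.set j c) q + [q ≤ xs[j]] = expo xs q + [q ≤ c]`. [folklore] -/
theorem expo_set (xs : List ℕ) :
    ∀ (j : ℕ) (hj : j < xs.length) (c q : ℕ),
      expo (xs.set j c) q + (if q ≤ xs[j] then 1 else 0) = expo xs q + (if q ≤ c then 1 else 0) := by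
  induction xs with
  | nil => intro j hj; simp at hj
  | cons x t ih =>
    intro j hj c q
    cases j with
    | zero =>
      simp only [List.set_cons_zero, List.getElem_cons_zero]
      rw [expo_cons, expo_cons]
      by_cases h1 : q ≤ x <;> by_cases h2 : q ≤ c <;> simp only [h1, h2, if_true, if_false] <;> omega
    | succ j =>
      simp only [List.set_cons_succ, List.getElem_cons_succ, List.length_cons] at hj ⊢
      rw [expo_cons, expo_cons]
      have := ih j (by omega) c q
      by_cases h1 : q ≤ t[j] <;> by_cases h2 : q ≤ x <;>
        simp only [h1, h2, if_true, if_false] at this ⊢ <;> omega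

/-- For non-increasing thresholds, the thresholds `≥ q` form an initial segment:
`q ≤ xs[i] ↔ i + 1 ≤ expo xs q`. [folklore] -/
theorem expo_initial (xs : List ℕ) (hs : xs.Pairwise (· ≥ ·)) (q : ℕ) :
    ∀ i : ℕ, (hi : i < xs.length) → (q ≤ xs[i] ↔ i + 1 ≤ expo xs q) := by
  induction xs with
  | nil => intro i hi; simp at hi
  | cons x t ih =>
    rw [List.pairwise_cons] at hs
    intro i hi
    rw [expo_cons]
    -- if `q > x` then no threshold is `≥ q`
    have hzero : ¬ q ≤ x → expo t q = 0 := by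
      intro h
      unfold expo
      rw [List.length_eq_zero_iff, List.filter_eq_nil_iff]
      intro y hy
      have := hs.1 y hy
      simp only [decide_eq_true_eq]
      omega
    cases i with
    | zero =>
      simp only [List.getElem_cons_zero, zero_add]
      by_cases h : q ≤ x
      · rw [if_pos h]; exact ⟨fun _ => by omega, fun _ => h⟩
      · rw [if_neg h, hzero h]; exact ⟨fun h' => absurd h' h, fun h' => by omega⟩
    | succ i =>
      simp only [List.getElem_cons_succ, List.length_cons] at hi ⊢
      rw [ih hs.2 i (by omega)]
      by_cases h : q ≤ x
      · rw [if_pos h]; omega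
      · rw [if_neg h, hzero h]
        have := expo_le_length t q
        constructor
        · intro h1; omega
        · intro h1; omega

/-- `N(xs) = ∏_{q ∈ T} q^{expo q}`. [folklore] -/
def Nnat (T : List ℕ) (xs : List ℕ) : ℕ := (T.map fun q => q ^ expo xs q).prod

/-- `L(xs) = ∑_{q ∈ T} expo(q) log q` (`= log N`). [folklore] -/
noncomputable def Lreal (T : List ℕ) (xs : List ℕ) : ℝ :=
  (T.map fun q => (expo xs q : ℝ) * Real.log q).sum

/-- `S(xs) = ∑_{q ∈ T} (log σ_{expo q}(q) − expo(q) log q)` (`= log(σ(N)/N)` for a table of primes).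
[folklore] -/
noncomputable def Sreal (T : List ℕ) (xs : List ℕ) : ℝ :=
  (T.map fun q => Real.log (gsum q (expo xs q)) - (expo xs q : ℝ) * Real.log q).sum

/-- `Θ_T(x) = ∑_{q ∈ T, q ≤ x} log q` (`≥ θ(x)` for a complete table). [folklore] -/
noncomputable def ThT (T : List ℕ) (x : ℕ) : ℝ :=
  (T.map fun q => if q ≤ x then Real.log q else 0).sum

/-- Generic one-point update of a sum over a duplicate-free list. [folklore] -/
theorem sum_map_update {T : List ℕ} (hT : T.Nodup) {c : ℕ} (hc : c ∈ T) (f g : ℕ → ℝ)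
    (hfg : ∀ q ∈ T, q ≠ c → g q = f q) : (T.map g).sum = (T.map f).sum + (g c - f c) := by
  induction T with
  | nil => simp at hc
  | cons a t ih =>
    rw [List.nodup_cons] at hT
    simp only [List.map_cons, List.sum_cons]
    rcases List.mem_cons.1 hc with rfl | hc
    · have : (t.map g).sum = (t.map f).sum := by
        congr 1
        exact List.map_congr_left fun q hq => hfg q (List.mem_cons_of_mem _ hq) (fun h => hT.1 (h ▸ hq))
      rw [this]; ring
    · have hac : a ≠ c := fun h => hT.1 (h ▸ hc)
      rw [ih hT.2 hc (fun q hq => hfg q (List.mem_cons_of_mem _ hq)), hfg a (by simp) hac]; ring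

/-- A sum over a duplicate-free list is unchanged if the summands agree on it. [folklore] -/
theorem sum_map_congr' {T : List ℕ} (f g : ℕ → ℝ) (hfg : ∀ q ∈ T, g q = f q) :
    (T.map g).sum = (T.map f).sum := by
  congr 1; exact List.map_congr_left hfg

/-- Generic one-point update of a product over a duplicate-free list: multiplying the factor at
`c` by `c`. [folklore] -/
theorem prod_map_update {T : List ℕ} (hT : T.Nodup) {c : ℕ} (hc : c ∈ T) (f g : ℕ → ℕ)
    (hfg : ∀ q ∈ T, q ≠ c → g q = f q) (hgc : g c = f c * c) : (T.map g).prod = (T.map f).prod * c := by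
  induction T with
  | nil => simp at hc
  | cons a t ih =>
    rw [List.nodup_cons] at hT
    simp only [List.map_cons, List.prod_cons]
    rcases List.mem_cons.1 hc with rfl | hc
    · have : (t.map g).prod = (t.map f).prod := by
        congr 1
        exact List.map_congr_left fun q hq => hfg q (List.mem_cons_of_mem _ hq) (fun h => hT.1 (h ▸ hq))
      rw [this, hgc]; ring
    · have hac : a ≠ c := fun h => hT.1 (h ▸ hc)
      rw [ih hT.2 hc (fun q hq => hfg q (List.mem_cons_of_mem _ hq)), hfg a (by simp) hac]; ring

/-- `log N = L`. [folklore] -/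
theorem log_Nnat (h2 : ∀ q ∈ T, 2 ≤ q) (xs : List ℕ) :
    Real.log (Nnat T xs : ℕ) = Lreal T xs := by
  unfold Nnat Lreal
  induction T with
  | nil => simp
  | cons a t ih =>
    simp only [List.map_cons, List.prod_cons, List.sum_cons, Nat.cast_mul, Nat.cast_pow]
    have ha : (0 : ℝ) < a := by have := h2 a (by simp); positivity
    have hpos : (0 : ℝ) < ((t.map fun q => q ^ expo xs q).prod : ℕ) := by
      have : 0 < (t.map fun q => q ^ expo xs q).prod := by
        apply List.prod_pos
        intro y hy
        rw [List.mem_map] at hy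
        obtain ⟨q, hq, rfl⟩ := hy
        have := h2 q (List.mem_cons_of_mem _ hq)
        positivity
      exact_mod_cast this
    rw [Real.log_mul (pow_pos ha _).ne' hpos.ne', Real.log_pow, ih (fun q hq => h2 q (List.mem_cons_of_mem _ hq))]

/-- `N ≥ 1`. [folklore] -/
theorem Nnat_pos (h2 : ∀ q ∈ T, 2 ≤ q) (xs : List ℕ) : 0 < Nnat T xs := by
  unfold Nnat
  apply List.prod_pos
  intro y hy
  rw [List.mem_map] at hy
  obtain ⟨q, hq, rfl⟩ := hy
  have := h2 q hq
  positivity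

/-- `θ(y) ≤ Θ_T(x)` whenever every prime `p ≤ y` is a table entry `≤ x`. [folklore] -/
theorem theta_le_ThT (hT : T.Pairwise (· < ·)) (h2 : ∀ q ∈ T, 2 ≤ q) {x : ℕ} {y : ℝ}
    (h : ∀ p : ℕ, p.Prime → (p : ℝ) ≤ y → p ∈ T ∧ p ≤ x) : Chebyshev.theta y ≤ ThT T x := by
  classical
  have hnd : T.Nodup := hT.imp ne_of_lt
  rw [Chebyshev.theta_eq_sum_primesLE]
  unfold ThT
  rw [← List.sum_toFinset _ hnd]
  have hmem : ∀ p ∈ Nat.primesLE ⌊y⌋₊, p ∈ T ∧ p ≤ x := by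
    intro p hp
    rw [Nat.mem_primesLE] at hp
    refine h p hp.2 ?_
    have h1 : 1 ≤ ⌊y⌋₊ := le_trans hp.2.one_lt.le hp.1
    have hy : 0 ≤ y := by
      have := Nat.floor_pos.1 h1; linarith
    exact le_trans (by exact_mod_cast hp.1) (Nat.floor_le hy)
  calc ∑ p ∈ Nat.primesLE ⌊y⌋₊, Real.log p
      = ∑ p ∈ Nat.primesLE ⌊y⌋₊, (if p ≤ x then Real.log p else 0) := by
        refine Finset.sum_congr rfl fun p hp => ?_
        rw [if_pos (hmem p hp).2]
    _ ≤ ∑ p ∈ T.toFinset, (if p ≤ x then Real.log p else 0) := by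
        apply Finset.sum_le_sum_of_subset_of_nonneg
        · intro p hp
          rw [List.mem_toFinset]
          exact (hmem p hp).1
        · intro q hq _
          rw [List.mem_toFinset] at hq
          have := h2 q hq
          split_ifs
          · exact Real.log_nonneg (by exact_mod_cast (by omega : 1 ≤ q))
          · exact le_rfl

end Semantics

/-! ## Part 5: the envelope from the ratio conditions -/

section EnvelopeSound

variable {T : List ℕ} {tmax : ℕ}

/-- The virtual extension of the thresholds: `xsV xs j = xs[j]` for `j < K` and `1` beyond.
[folklore] -/
def xsV (xs : List ℕ) (j : ℕ) : ℕ := xs.getD j 1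

/-- `xsV` inside the list is the list entry. [folklore] -/
theorem xsV_of_lt {xs : List ℕ} {j : ℕ} (hj : j < xs.length) : xsV xs j = xs[j] := by
  simp [xsV, List.getD_eq_getElem?_getD, List.getElem?_eq_getElem hj]

/-- `xsV` at the length is the virtual threshold `1`. [folklore] -/
theorem xsV_length (xs : List ℕ) : xsV xs xs.length = 1 := by
  simp [xsV, List.getD_eq_getElem?_getD]

/-- The ratio condition "up" (invariant): every threshold entered its level with ratio `≥ 1`.
[folklore] -/
def CondUp (xs : List ℕ) (ε : ℝ) : Prop :=
  ∀ j : ℕ, (hj : j < xs.length) → 1 ≤ ratioF ε (xs[j] : ℝ) j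

/-- The ratio condition "down" (checked at every step): every level's candidate has ratio `≤ 1`.
[folklore] -/
def CondDown (T : List ℕ) (xs : List ℕ) (ε : ℝ) : Prop :=
  ∀ j : ℕ, j ≤ xs.length → ratioF ε (succT T (xsV xs j) : ℝ) j ≤ 1

/-- `F_ε(q^a) > 0` at a prime. [folklore] -/
theorem sigmaRpow_prime_pow_pos (ε : ℝ) {q : ℕ} (hq : q.Prime) (a : ℕ) : 0 < Nat.sigmaRpow ε (q ^ a) := by
  unfold Nat.sigmaRpow
  have h1 : (0 : ℝ) < ((q ^ a : ℕ) : ℝ) := by exact_mod_cast pow_pos hq.pos a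
  exact div_pos (sigma_pow_pos hq a) (Real.rpow_pos_of_pos h1 _)

/-- `log F_ε(q^a) = log σ_a(q) − a (1+ε) log q` at a prime. [folklore] -/
theorem log_sigmaRpow_prime_pow (ε : ℝ) {q : ℕ} (hq : q.Prime) (a : ℕ) :
    Real.log (Nat.sigmaRpow ε (q ^ a)) = Real.log (gsum q a) - a * (1 + ε) * Real.log q := by
  unfold Nat.sigmaRpow
  have hq0 : (0 : ℝ) < q := by exact_mod_cast hq.pos
  have hs : (0 : ℝ) < ArithmeticFunction.sigma 1 (q ^ a) := sigma_pow_pos hq a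
  have h1 : (0 : ℝ) < ((q ^ a : ℕ) : ℝ) := by exact_mod_cast pow_pos hq.pos a
  rw [Real.log_div hs.ne' (Real.rpow_pos_of_pos h1 _).ne', ← gsum_eq_sigma hq,
    Real.log_rpow h1]
  push_cast
  rw [Real.log_pow]
  ring

/-- `S − ε L` as a single sum. [folklore] -/
theorem Sreal_sub_eps_Lreal (T : List ℕ) (xs : List ℕ) (ε : ℝ) :
    Sreal T xs - ε * Lreal T xs =
      (T.map fun q => Real.log (gsum q (expo xs q)) - (expo xs q : ℝ) * (1 + ε) * Real.log q).sum := by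
  unfold Sreal Lreal
  induction T with
  | nil => simp
  | cons a t ih =>
    simp only [List.map_cons, List.sum_cons]
    rw [← ih]; ring

/-- **The envelope.** For an admissible table, non-increasing thresholds `x₁ ≥ ⋯ ≥ x_K` (all `≥ 1`)
with a table entry above `x₁`, `ε ≥ 0`, and the two ratio conditions, every `m ≥ 1` satisfies
`σ(m)/m^{1+ε} ≤ exp(S − ε L)`. [cite: AlaogluErdos1944, §3] -/
theorem envelope (hT : TableOK T tmax) {xs : List ℕ} (hsort : xs.Pairwise (· ≥ ·))
    (hne : xs ≠ []) (hone : ∀ x ∈ xs, 1 ≤ x) (htop : after (xs.head hne) T ≠ []) {ε : ℝ} (hε : 0 ≤ ε)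
    (hup : CondUp xs ε) (hdown : CondDown T xs ε) {m : ℕ} (hm : 1 ≤ m) :
    Nat.sigmaRpow ε m ≤ Real.exp (Sreal T xs - ε * Lreal T xs) := by
  classical
  obtain ⟨P, xt, rfl⟩ := List.exists_cons_of_ne_nil hne
  simp only [List.head_cons] at htop
  set xs := P :: xt with hxs
  set K := xs.length with hK
  have hnd : T.Nodup := hT.sorted.imp ne_of_lt
  have hK0 : 0 < K := by simp [hK, hxs]
  have hxs0 : xs[0] = P := by simp [hxs]
  have hxsle : ∀ j (hj : j < K), xs[j] ≤ P := by
    intro j hj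
    cases j with
    | zero => simp [hxs]
    | succ j =>
      have hs := hsort
      rw [hxs, List.pairwise_cons] at hs
      simp only [hxs, List.getElem_cons_succ]
      exact hs.1 _ (List.getElem_mem _)
  have hP1 : 1 ≤ P := hone P (by simp [hxs])
  -- every `after (xsV j) T` is non-empty
  have hafter : ∀ j, j ≤ K → after (xsV xs j) T ≠ [] := by
    intro j hj
    rcases Nat.lt_or_ge j K with hjK | hjK
    · rw [xsV_of_lt hjK]; exact after_ne_nil_of_le hT.sorted (hxsle j hjK) htop
    · have : j = K := le_antisymm hj hjK
      subst this
      rw [xsV_length]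
      exact after_ne_nil_of_le hT.sorted hP1 htop
  obtain ⟨hc0T, hPc0, hc0min⟩ := succT_spec hT.sorted htop
  have hPt : P ≤ tmax := hPc0.le.trans (hT.bounded _ hc0T)
  have hx0 : xsV xs 0 = P := by rw [xsV_of_lt hK0, hxs0]
  -- for `a = expo q ≥ 1` (`q ≥ 2`): `q ≤ xs[a-1]` and `xsV a < q`
  have hinit1 : ∀ q : ℕ, (ha : 1 ≤ expo xs q) →
      q ≤ xs[expo xs q - 1]'(by have := expo_le_length xs q; omega) := by
    intro q ha1
    exact (expo_initial xs hsort q (expo xs q - 1) _).2 (by omega)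
  have hinit2 : ∀ q : ℕ, 2 ≤ q → xsV xs (expo xs q) < q := by
    intro q hq2
    have haK : expo xs q ≤ K := expo_le_length _ _
    rcases Nat.lt_or_ge (expo xs q) K with haK' | haK'
    · rw [xsV_of_lt haK']
      by_contra hh
      push Not at hh
      have := (expo_initial xs hsort q (expo xs q) haK').1 hh
      omega
    · rw [le_antisymm haK haK', xsV_length]
      omega
  -- `ratioF ε q b ≥ 1` for `b < expo q` (from `CondUp`), for `q ≥ 1`
  have hup_q : ∀ q : ℕ, 1 ≤ q → ∀ b : ℕ, b < expo xs q → 1 ≤ ratioF ε (q : ℝ) b := by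
    intro q hq1 b hb
    have haK : expo xs q ≤ K := expo_le_length _ _
    have hq1R : (1 : ℝ) ≤ q := by exact_mod_cast hq1
    have hlt : expo xs q - 1 < K := by omega
    have hqx : q ≤ xs[expo xs q - 1] := hinit1 q (by omega)
    calc (1 : ℝ) ≤ ratioF ε (xs[expo xs q - 1] : ℝ) (expo xs q - 1) := hup _ hlt
      _ ≤ ratioF ε (q : ℝ) (expo xs q - 1) := ratioF_antitone hε hq1R (by exact_mod_cast hqx) _
      _ ≤ ratioF ε (q : ℝ) b := ratioF_anti_index ε hq1R (by omega)
  -- `ratioF ε q (expo q) ≤ 1` for table entries `q` (from `CondDown`)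
  have hdown_q : ∀ q : ℕ, q ∈ T → ratioF ε (q : ℝ) (expo xs q) ≤ 1 := by
    intro q hqT
    have hq2 : 2 ≤ q := hT.two_le q hqT
    have haK : expo xs q ≤ K := expo_le_length _ _
    have hya := hafter (expo xs q) haK
    obtain ⟨hcT, -, hcmin⟩ := succT_spec hT.sorted hya
    have hcq : succT T (xsV xs (expo xs q)) ≤ q := hcmin q hqT (hinit2 q hq2)
    have hc1 : (1 : ℝ) ≤ succT T (xsV xs (expo xs q)) := by
      exact_mod_cast le_trans (by norm_num) (hT.two_le _ hcT)
    calc ratioF ε (q : ℝ) (expo xs q)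
        ≤ ratioF ε (succT T (xsV xs (expo xs q)) : ℝ) (expo xs q) :=
          ratioF_antitone hε hc1 (by exact_mod_cast hcq) _
      _ ≤ 1 := hdown _ haK
  -- Step 1: the envelope over primes `≤ P`
  have hmax : ∀ q : ℕ, q.Prime → q ≤ P → ∀ b : ℕ,
      Nat.sigmaRpow ε (q ^ b) ≤ Nat.sigmaRpow ε (q ^ expo xs q) := by
    intro q hq hqP b
    have ha1 : 1 ≤ expo xs q := by rw [hxs, expo_cons, if_pos hqP]; omega
    have hqT : q ∈ T := hT.complete q hq (hqP.trans hPt)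
    refine sigmaRpow_pow_le_of_ratio hq (Or.inr ?_) ?_ b
    · rw [ratio_eq_ratioF ε hq]; exact hup_q q hq.one_lt.le _ (by omega)
    · rw [ratio_eq_ratioF ε hq]; exact hdown_q q hqT
  have htail : ∀ q : ℕ, q.Prime → P < q → ∀ b : ℕ, Nat.sigmaRpow ε (q ^ b) ≤ 1 := by
    intro q hq hPq b
    refine sigmaRpow_pow_le_one_of_ratio hq ?_ b
    rw [ratio_eq_ratioF ε hq]
    have hcq : succT T P ≤ q := succT_le_of_prime hT htop hq hPq
    have hc1 : (1 : ℝ) ≤ succT T P := by exact_mod_cast le_trans (by norm_num) (hT.two_le _ hc0T)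
    calc ratioF ε (q : ℝ) 0 ≤ ratioF ε (succT T P : ℝ) 0 := ratioF_antitone hε hc1 (by exact_mod_cast hcq) _
      _ ≤ 1 := by have := hdown 0 (Nat.zero_le _); rwa [hx0] at this
  have hm0 : m ≠ 0 := by omega
  have step1 := sigmaRpow_le_prod (ε := ε) (P := P) (a := expo xs) hmax htail hm0
  -- Step 2: the prime product is at most `exp(S − εL)`
  refine step1.trans ?_
  set φ : ℕ → ℝ := fun q => Real.log (gsum q (expo xs q)) - (expo xs q : ℝ) * (1 + ε) * Real.log q
    with hφ
  have hprodpos : 0 < ∏ q ∈ Nat.primesLE P, Nat.sigmaRpow ε (q ^ expo xs q) := by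
    apply Finset.prod_pos
    intro q hq
    rw [Nat.mem_primesLE] at hq
    exact sigmaRpow_prime_pow_pos ε hq.2 _
  rw [← Real.exp_log hprodpos, Real.exp_le_exp, Real.log_prod]
  swap
  · intro q hq
    rw [Nat.mem_primesLE] at hq
    exact (sigmaRpow_prime_pow_pos ε hq.2 _).ne'
  rw [Sreal_sub_eps_Lreal, ← List.sum_toFinset _ hnd]
  calc ∑ q ∈ Nat.primesLE P, Real.log (Nat.sigmaRpow ε (q ^ expo xs q))
      = ∑ q ∈ Nat.primesLE P, φ q := by
        refine Finset.sum_congr rfl fun q hq => ?_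
        rw [Nat.mem_primesLE] at hq
        rw [hφ, log_sigmaRpow_prime_pow ε hq.2]
    _ ≤ ∑ q ∈ T.toFinset, φ q := by
        apply Finset.sum_le_sum_of_subset_of_nonneg
        · intro q hq
          rw [Nat.mem_primesLE] at hq
          rw [List.mem_toFinset]
          exact hT.complete q hq.2 (hq.1.trans hPt)
        · intro q hqT _
          rw [List.mem_toFinset] at hqT
          have hq1 : 1 ≤ q := le_trans (by norm_num) (hT.two_le q hqT)
          have hq1R : (1 : ℝ) ≤ q := by exact_mod_cast hq1
          -- `φ q = ∑_{b < a} log ratioF ε q b ≥ 0`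
          have htel := sum_log_ratioF ε hq1R (expo xs q)
          rw [← gsum_eq_geomSum] at htel
          have : φ q = ∑ b ∈ range (expo xs q), Real.log (ratioF ε (q : ℝ) b) := by
            rw [htel, hφ]
          rw [this]
          apply Finset.sum_nonneg
          intro b hb
          rw [Finset.mem_range] at hb
          exact Real.log_nonneg (hup_q q hq1 b hb)

end EnvelopeSound

/-! ## Part 6: Robin's inequality on a step interval -/

section RobinInterval


/-- **Robin's inequality between two consecutive numbers of the chain.** If `M ≥ σ(m)/m^{1+ε}` for
all `m ≥ 1` (`ε ≥ 0`), `3 ≤ N ≤ N'`, and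
`log M + ε log N' < γ + log log log N'`, `log M + ε log N < γ + log log log N`, then Robin's
inequality holds for every `n ∈ [N, N']` (concavity of `u ↦ log log u − ε u` on `(1, ∞)`).
[cite: Robin1984, §3 Prop. 1 (proof)] -/
theorem robin_of_envelope {ε M : ℝ} (hε : 0 ≤ ε) {N N' : ℕ} (hN : 3 ≤ N)
    (henv : ∀ m : ℕ, 1 ≤ m → Nat.sigmaRpow ε m ≤ M)
    (h1 : Real.log M + ε * Real.log N' < Real.eulerMascheroniConstant + Real.log (Real.log (Real.log N')))
    (h2 : Real.log M + ε * Real.log N < Real.eulerMascheroniConstant + Real.log (Real.log (Real.log N)))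
    {n : ℕ} (hNn : N ≤ n) (hnN' : n ≤ N') : robinInequality n := by
  have hn3 : 3 ≤ n := hN.trans hNn
  have hN0 : (0 : ℝ) < N := by exact_mod_cast (show 0 < N by omega)
  have hn0 : (0 : ℝ) < n := by exact_mod_cast (show 0 < n by omega)
  have hMpos : 0 < M := lt_of_lt_of_le (by rw [Nat.sigmaRpow_one]; norm_num) (henv 1 le_rfl)
  have ha : 1 < Real.log (N : ℝ) := by
    have h3 : (3 : ℝ) ≤ N := by exact_mod_cast hN
    have := Real.exp_one_lt_d9
    rw [Real.lt_log_iff_exp_lt hN0]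
    linarith
  have hlogn : 1 < Real.log (n : ℝ) := lt_of_lt_of_le ha (Real.log_le_log hN0 (by exact_mod_cast hNn))
  have h₁ : Real.log (N : ℝ) ≤ Real.log (n : ℝ) := Real.log_le_log hN0 (by exact_mod_cast hNn)
  have h₂ : Real.log (n : ℝ) ≤ Real.log (N' : ℝ) := Real.log_le_log hn0 (by exact_mod_cast hnN')
  -- concavity: the value at `log n` is at least the value at one endpoint
  have hmid : Real.log M + ε * Real.log n <
      Real.eulerMascheroniConstant + Real.log (Real.log (Real.log n)) := by
    rcases loglog_sub_linear_endpoint_le hε ha h₁ h₂ with h | h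
    · linarith
    · linarith
  -- conclude
  unfold robinInequality
  have hσ : (ArithmeticFunction.sigma 1 n : ℝ) = Nat.sigmaRpow ε n * (n : ℝ) ^ (1 + ε) := by
    unfold Nat.sigmaRpow
    rw [div_mul_cancel₀ _ (by positivity)]
  have hle : Nat.sigmaRpow ε n ≤ M := henv n (by omega)
  have hll : 0 < Real.log (Real.log (n : ℝ)) := Real.log_pos hlogn
  -- `M n^{1+ε} < e^γ n log log n` in logarithmic form
  have key : M * (n : ℝ) ^ (1 + ε) < Real.exp Real.eulerMascheroniConstant * n * Real.log (Real.log n) := by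
    have e1 : M * (n : ℝ) ^ (1 + ε) = Real.exp (Real.log M + (1 + ε) * Real.log n) := by
      rw [Real.exp_add, Real.exp_log hMpos, ← Real.log_rpow hn0, Real.exp_log (by positivity)]
    have e2 : Real.exp Real.eulerMascheroniConstant * n * Real.log (Real.log n) =
        Real.exp (Real.eulerMascheroniConstant + Real.log n + Real.log (Real.log (Real.log n))) := by
      rw [Real.exp_add, Real.exp_add, Real.exp_log hn0, Real.exp_log hll]
    rw [e1, e2, Real.exp_lt_exp]
    nlinarith
  calc (ArithmeticFunction.sigma 1 n : ℝ) = Nat.sigmaRpow ε n * (n : ℝ) ^ (1 + ε) := hσ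
    _ ≤ M * (n : ℝ) ^ (1 + ε) := mul_le_mul_of_nonneg_right hle (by positivity)
    _ < Real.exp Real.eulerMascheroniConstant * n * Real.log (Real.log n) := key

end RobinInterval

/-! ## Part 7: the checks of a step -/

section Checks

/-- **Soundness of `logScaledLo`**: if `x ≥ n/2^t > 0` then `logScaledLo t n = some a` gives
`a/2⁸⁰ ≤ log x`. [folklore] -/
theorem logScaledLo_sound {t n : ℕ} {a : ℤ} (h : logScaledLo t n = some a) {x : ℝ} (hn : 1 ≤ n)
    (hx : (n : ℝ) / 2 ^ t ≤ x) : (a : ℝ) / 2 ^ 80 ≤ Real.log x := by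
  unfold logScaledLo at h
  match hl : Literature.Analysis.SpecialFunctions.KernelLog.logIv n, h with
  | some (lo', hi'), h =>
    simp only [Option.map_some, Option.some.injEq] at h
    obtain ⟨h1, -⟩ := Literature.Analysis.SpecialFunctions.KernelLog.logIv_sound hl
    have hn0 : (0 : ℝ) < n := by exact_mod_cast hn
    have hx0 : 0 < x := lt_of_lt_of_le (by positivity) hx
    have hlogx : Real.log ((n : ℝ) / 2 ^ t) ≤ Real.log x := Real.log_le_log (by positivity) hx
    rw [Real.log_div hn0.ne' (by positivity), Real.log_pow] at hlogx
    have hL2 : 2 ^ 80 * Real.log 2 ≤ ((Literature.Analysis.SpecialFunctions.KernelLog.L2HI : ℤ) : ℝ) := by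
      have e1 : (0.69314718055994530944 : ℚ) * 2 ^ 80 ≤ ((Literature.Analysis.SpecialFunctions.KernelLog.L2HI : ℤ) : ℚ) := Int.le_ceil _
      have e2 : (((0.69314718055994530944 : ℚ) * 2 ^ 80 : ℚ) : ℝ) ≤ (((Literature.Analysis.SpecialFunctions.KernelLog.L2HI : ℤ) : ℚ) : ℝ) := by
        exact_mod_cast e1
      have e3 := Literature.Analysis.SpecialFunctions.Real.log_two_lt_d20
      push_cast at e2
      nlinarith
    have ht0 : (0 : ℝ) ≤ t := by positivity
    have htL := mul_le_mul_of_nonneg_left hL2 ht0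
    rw [← h]
    push_cast
    rw [div_le_iff₀ (by positivity : (0 : ℝ) < 2 ^ 80)] at h1 ⊢
    nlinarith

/-- Auxiliary (proof-internal): for `z : ℤ`, `0 ≤ z`, `t ≤ s` and `Z ≥ z/2^s`,
`((z / 2^t).toNat)/2^{s−t} ≤ Z`. [folklore] -/
theorem toNat_div_pow_le {z : ℤ} {s t : ℕ} (hts : t ≤ s) (hz : 0 ≤ z) {Z : ℝ}
    (hZ : (z : ℝ) / 2 ^ s ≤ Z) : (((z / 2 ^ t).toNat : ℕ) : ℝ) / 2 ^ (s - t) ≤ Z := by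
  have hq0 : 0 ≤ z / 2 ^ t := Int.ediv_nonneg hz (by positivity)
  have h1 : (((z / 2 ^ t).toNat : ℕ) : ℝ) = ((z / 2 ^ t : ℤ) : ℝ) := by exact_mod_cast Int.toNat_of_nonneg hq0
  have h2 : (z / 2 ^ t) * 2 ^ t ≤ z := Int.ediv_mul_le _ (by positivity)
  have h2R : ((z / 2 ^ t : ℤ) : ℝ) * 2 ^ t ≤ z := by exact_mod_cast h2
  have e : (2 : ℝ) ^ s = 2 ^ (s - t) * 2 ^ t := by rw [← pow_add, Nat.sub_add_cancel hts]
  rw [h1, div_le_iff₀ (by positivity)]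
  rw [div_le_iff₀ (by positivity), e] at hZ
  have h3 : ((z / 2 ^ t : ℤ) : ℝ) * 2 ^ t ≤ Z * 2 ^ (s - t) * 2 ^ t := by linarith
  exact le_of_mul_le_mul_right h3 (by positivity)

/-- **Soundness of `lllLo`**: if `2⁸⁰ L ≥ Llo` and `lllLo Llo = some b`, then `b/2⁸⁰ ≤ log log L`.
[folklore] -/
theorem lllLo_sound {Llo b : ℤ} (h : lllLo Llo = some b) {L : ℝ} (hL : (Llo : ℝ) / 2 ^ 80 ≤ L) :
    (b : ℝ) / 2 ^ 80 ≤ Real.log (Real.log L) := by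
  unfold lllLo at h
  rcases ha : logScaledLo 10 (Llo / 2 ^ 70).toNat with _ | a
  · rw [ha] at h; simp at h
  · rw [ha] at h
    dsimp only at h
    split_ifs at h with hpos
    push Not at hpos
    have hm1 : 1 ≤ (Llo / 2 ^ 70).toNat := by
      by_contra h0
      push Not at h0
      have : (Llo / 2 ^ 70).toNat = 0 := by omega
      rw [this] at ha
      simp [logScaledLo, Literature.Analysis.SpecialFunctions.KernelLog.logIv] at ha
    have hLlo0 : 0 ≤ Llo := by
      by_contra hneg
      push Not at hneg
      have hq : Llo / 2 ^ 70 < 0 := Int.ediv_neg_of_neg_of_pos hneg (by positivity)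
      have : (Llo / 2 ^ 70).toNat = 0 := Int.toNat_eq_zero.2 hq.le
      omega
    have hmL : (((Llo / 2 ^ 70).toNat : ℕ) : ℝ) / 2 ^ 10 ≤ L := by
      have := toNat_div_pow_le (t := 70) (s := 80) (by norm_num) hLlo0 hL
      simpa using this
    have h1 := logScaledLo_sound ha hm1 hmL
    have hm'1 : 1 ≤ (a / 2 ^ 50).toNat := by
      by_contra h0
      push Not at h0
      have : (a / 2 ^ 50).toNat = 0 := by omega
      rw [this] at h
      simp [logScaledLo, Literature.Analysis.SpecialFunctions.KernelLog.logIv] at h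
    have hm'L : (((a / 2 ^ 50).toNat : ℕ) : ℝ) / 2 ^ 30 ≤ Real.log L := by
      have := toNat_div_pow_le (t := 50) (s := 80) (by norm_num) hpos.le h1
      simpa using this
    exact logScaledLo_sound h hm'1 hm'L

/-- **Soundness of `lllLoN`**: `lllLoN Llo = some v` and `Llo ≤ 2⁸⁰ L` give `v ≤ 2⁸⁰ log log L`.
[folklore] -/
theorem lllLoN_sound {Llo v : ℕ} (h : lllLoN Llo = some v) {L : ℝ} (hL : (Llo : ℝ) ≤ 2 ^ 80 * L) :
    (v : ℝ) ≤ 2 ^ 80 * Real.log (Real.log L) := by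
  unfold lllLoN at h
  rcases hb : lllLo (Llo : ℤ) with _ | b
  · rw [hb] at h; simp at h
  · rw [hb] at h
    simp only at h
    split_ifs at h with hpos
    push Not at hpos
    simp only [Option.some.injEq] at h
    subst h
    have hL' : ((Llo : ℤ) : ℝ) / 2 ^ 80 ≤ L := by
      push_cast; rw [div_le_iff₀ (by positivity)]; linarith
    have h1 := lllLo_sound hb hL'
    have e : ((b.toNat : ℕ) : ℝ) = (b : ℝ) := by exact_mod_cast Int.toNat_of_nonneg hpos.le
    rw [e]
    rw [div_le_iff₀ (by positivity)] at h1
    linarith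

/-- **Soundness of `robinChk`.** With `S' ≤ Shi'/2⁸⁰`, `Bc ≤ 2⁸⁰ log c`, `Llo ≤ 2⁸⁰ log N`,
`Llo' ≤ 2⁸⁰ log N'`, a cached bound `lll ≤ 2⁸⁰ log log log N`, and `log log log N ≤ log log log N'`:
the returned value bounds `2⁸⁰ log log log N'` from below, and Robin's inequality holds in envelope
form at both ends: `S' < γ + log log log N'`, `S' − (e/2⁸⁰) log c < γ + log log log N`. [folklore] -/
theorem robinChk_sound {Shi' e Bc Llo Llo' lll lll' : ℕ}
    (h : robinChk Shi' e Bc Llo Llo' lll = some lll') {S' lc LN LN' : ℝ}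
    (hS : 2 ^ 80 * S' ≤ Shi') (hBc : (Bc : ℝ) ≤ 2 ^ 80 * lc)
    (hLlo : (Llo : ℝ) ≤ 2 ^ 80 * LN) (hLlo' : (Llo' : ℝ) ≤ 2 ^ 80 * LN')
    (hlll : (lll : ℝ) ≤ 2 ^ 80 * Real.log (Real.log LN))
    (hmono : Real.log (Real.log LN) ≤ Real.log (Real.log LN')) :
    (lll' : ℝ) ≤ 2 ^ 80 * Real.log (Real.log LN') ∧
      S' < Real.eulerMascheroniConstant + Real.log (Real.log LN') ∧
      S' - (e : ℝ) / 2 ^ 80 * lc < Real.eulerMascheroniConstant + Real.log (Real.log LN) := by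
  have hG := GAMMALO_le
  -- the truncated left-hand side at `N`
  have hm := (mulLo_bounds e Bc).1
  have he0 : (0 : ℝ) ≤ e := by positivity
  have hlhs : 2 ^ 80 * (S' - (e : ℝ) / 2 ^ 80 * lc) ≤ ((Nat.sub Shi' (mulLo e Bc) : ℕ) : ℝ) := by
    rw [Nat.sub_eq]
    have h1 : (e : ℝ) * Bc / 2 ^ 80 ≤ e * lc := by
      rw [div_le_iff₀ (by positivity)]
      nlinarith
    have h2 : 2 ^ 80 * (S' - (e : ℝ) / 2 ^ 80 * lc) = 2 ^ 80 * S' - e * lc := by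
      field_simp
    rw [h2]
    rcases le_or_gt (mulLo e Bc) Shi' with hle | hlt
    · rw [Nat.cast_sub hle]; linarith
    · rw [Nat.sub_eq_zero_of_le hlt.le]
      have : (Shi' : ℝ) < mulLo e Bc := by exact_mod_cast hlt
      push_cast; linarith
  unfold robinChk at h
  simp only [Nat.add_eq] at h
  -- analyse the first check
  set lhs2 := Nat.sub Shi' (mulLo e Bc) with hlhs2
  have key2 : ∀ v : ℕ, (v : ℝ) ≤ 2 ^ 80 * Real.log (Real.log LN) → Nat.blt lhs2 (GAMMALO + v) = true →
      S' - (e : ℝ) / 2 ^ 80 * lc < Real.eulerMascheroniConstant + Real.log (Real.log LN) := by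
    intro v hv hb
    have hlt : lhs2 < GAMMALO + v := by simpa [Nat.blt_eq] using hb
    have hltR : (lhs2 : ℝ) < GAMMALO + v := by exact_mod_cast hlt
    nlinarith
  have key1 : ∀ w : ℕ, (w : ℝ) ≤ 2 ^ 80 * Real.log (Real.log LN') → Nat.blt Shi' (GAMMALO + w) = true →
      S' < Real.eulerMascheroniConstant + Real.log (Real.log LN') := by
    intro w hw hb
    have hlt : Shi' < GAMMALO + w := by simpa [Nat.blt_eq] using hb
    have hltR : (Shi' : ℝ) < GAMMALO + w := by exact_mod_cast hlt
    nlinarith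
  -- first stage: a bound `v` valid at `N` with the check at `N`
  have stage1 : ∃ v : ℕ, (v : ℝ) ≤ 2 ^ 80 * Real.log (Real.log LN) ∧
      S' - (e : ℝ) / 2 ^ 80 * lc < Real.eulerMascheroniConstant + Real.log (Real.log LN) ∧
      (bif Nat.blt Shi' (GAMMALO + v) then some v else
        match lllLoN Llo' with
        | none => none
        | some w => bif Nat.blt Shi' (GAMMALO + w) then some w else none) = some lll' := by
    cases hb : Nat.blt lhs2 (GAMMALO + lll) with
    | true =>
      rw [hb] at h
      simp only [cond_true] at h
      exact ⟨lll, hlll, key2 lll hlll hb, h⟩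
    | false =>
      rw [hb] at h
      simp only [cond_false] at h
      rcases hv : lllLoN Llo with _ | v
      · rw [hv] at h; simp at h
      · rw [hv] at h
        simp only at h
        have hvs := lllLoN_sound hv hLlo
        cases hb2 : Nat.blt lhs2 (GAMMALO + v) with
        | false => rw [hb2] at h; simp at h
        | true =>
          rw [hb2] at h
          simp only [cond_true] at h
          exact ⟨v, hvs, key2 v hvs hb2, h⟩
  obtain ⟨v, hv, h2done, hrest⟩ := stage1
  have hv' : (v : ℝ) ≤ 2 ^ 80 * Real.log (Real.log LN') := by nlinarith
  cases hb : Nat.blt Shi' (GAMMALO + v) with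
  | true =>
    rw [hb] at hrest
    simp only [cond_true, Option.some.injEq] at hrest
    subst hrest
    exact ⟨hv', key1 v hv' hb, h2done⟩
  | false =>
    rw [hb] at hrest
    simp only [cond_false] at hrest
    rcases hw : lllLoN Llo' with _ | w
    · rw [hw] at hrest; simp at hrest
    · rw [hw] at hrest
      simp only at hrest
      have hws := lllLoN_sound hw hLlo'
      cases hb2 : Nat.blt Shi' (GAMMALO + w) with
      | false => rw [hb2] at hrest; simp at hrest
      | true =>
        rw [hb2] at hrest
        simp only [cond_true, Option.some.injEq] at hrest
        subst hrest
        exact ⟨hws, key1 w hws hb2, h2done⟩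

/-- `Nat.ble`/`Nat.blt` reflect `≤`/`<` (Boolean `false` cases). [folklore] -/
theorem ble_false {a b : ℕ} (h : Nat.ble a b = false) : ¬ a ≤ b := fun hh => by
  have : Nat.ble a b = true := by simpa [Nat.ble_eq] using hh
  rw [this] at h; exact absurd h (by decide)

/-- `Nat.blt a b = false` means `¬ a < b`. [folklore] -/
theorem blt_false {a b : ℕ} (h : Nat.blt a b = false) : ¬ a < b := fun hh => by
  have : Nat.blt a b = true := by simpa [Nat.blt_eq] using hh
  rw [this] at h; exact absurd h (by decide)

/-- `Nat.ble a b = true` means `a ≤ b`. [folklore] -/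
theorem ble_true {a b : ℕ} (h : Nat.ble a b = true) : a ≤ b := by simpa [Nat.ble_eq] using h

/-- `Nat.blt a b = true` means `a < b`. [folklore] -/
theorem blt_true {a b : ℕ} (h : Nat.blt a b = true) : a < b := by simpa [Nat.blt_eq] using h

/-- `maxima` bounds every `need`. [folklore] -/
theorem need_le_maxima : ∀ (ls : List Level) (L : Level), L ∈ ls → L.need ≤ (maxima ls).2
  | [], L, h => by simp at h
  | M :: t, L, h => by
      rcases hmt : maxima t with ⟨m, n⟩
      have ih : ∀ L', L' ∈ t → L'.need ≤ n := fun L' h' => by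
        have := need_le_maxima t L' h'; rwa [hmt] at this
      show L.need ≤ (maxima (M :: t)).2
      simp only [maxima, hmt]
      cases hb : Nat.ble M.need n with
      | false =>
        simp only [cond_false]
        have h1 := ble_false hb
        rcases List.mem_cons.1 h with rfl | h
        · exact le_rfl
        · have := ih L h; omega
      | true =>
        simp only [cond_true]
        rcases List.mem_cons.1 h with rfl | h
        · exact ble_true hb
        · exact ih L h

/-- `argmax` returns a valid position and that position's `ecrit`. [folklore] -/
theorem argmax_spec : ∀ ls : List Level, ls ≠ [] →
    ∃ L : Level, ls[(argmax ls).1]? = some L ∧ L.ecrit = (argmax ls).2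
  | [], h => absurd rfl h
  | M :: t, _ => by
      by_cases ht : t = []
      · subst ht
        have hb : Nat.blt M.ecrit 0 = false := by
          cases h : Nat.blt M.ecrit 0
          · rfl
          · exact absurd (blt_true h) (Nat.not_lt_zero _)
        refine ⟨M, ?_, ?_⟩ <;> simp [argmax, hb]
      · obtain ⟨L, hL, hLe⟩ := argmax_spec t ht
        rcases hat : argmax t with ⟨i, m⟩
        rw [hat] at hL hLe
        simp only [argmax, hat, Nat.add_eq]
        cases hb : Nat.blt M.ecrit m with
        | true => simp only [cond_true]; exact ⟨L, by simpa using hL, hLe⟩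
        | false => simp only [cond_false]; exact ⟨M, by simp, rfl⟩

/-- **Specification of `stepAt`.** [folklore] -/
theorem stepAt_spec (T : List ℕ) : ∀ (ls : List Level) (i xa : ℕ) (ls' : List Level) (c Ahi Blo : ℕ),
    stepAt T ls i xa = some (ls', c, Ahi, Blo) →
    ∃ L L' : Level, ls[i]? = some L ∧ L.rest.head? = some c ∧ Ahi = L.Ahi ∧ Blo = L.Blo ∧
      mkLevelNext L = some L' ∧
      (i = 0 → c ≤ xa) ∧ (∀ i' : ℕ, i = i' + 1 → ∀ M : Level, ls[i']? = some M → c ≤ M.x) ∧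
      (i + 1 < ls.length → ls' = ls.set i L') ∧
      (i + 1 = ls.length → ∃ V : Level, mkLevelB (L.j + 1) 1 T L2LON L2HIN = some V ∧
        ls' = ls.set i L' ++ [V])
  | [], i, xa, ls', c, Ahi, Blo, h => by cases i <;> simp [stepAt] at h
  | L :: t, 0, xa, ls', c, Ahi, Blo, h => by
      simp only [stepAt] at h
      rcases hr : L.rest with _ | ⟨c₀, r⟩
      · rw [hr] at h; simp at h
      · rw [hr] at h
        simp only at h
        cases hb : Nat.blt xa c₀ with
        | true => rw [hb] at h; simp at h
        | false =>
          rw [hb] at h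
          simp only [cond_false] at h
          have hxa : c₀ ≤ xa := Nat.le_of_not_lt (blt_false hb)
          rcases t with _ | ⟨M, t'⟩
          · -- virtual level
            rcases hn : mkLevelNext L with _ | L'
            · rw [hn] at h; simp at h
            · rw [hn] at h
              rcases hv : mkLevelB (Nat.add L.j 1) 1 T L2LON L2HIN with _ | V
              · rw [hv] at h; simp at h
              · rw [hv] at h
                simp only [Option.some.injEq, Prod.mk.injEq] at h
                obtain ⟨rfl, rfl, rfl, rfl⟩ := h
                refine ⟨L, L', by simp, by simp [hr], rfl, rfl, hn, fun _ => hxa, ?_, ?_, ?_⟩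
                · intro i' hi'; omega
                · intro hh; simp at hh
                · intro _
                  refine ⟨V, by rw [Nat.add_eq] at hv; exact hv, by simp⟩
          · rcases hn : mkLevelNext L with _ | L'
            · rw [hn] at h; simp at h
            · rw [hn] at h
              simp only [Option.some.injEq, Prod.mk.injEq] at h
              obtain ⟨rfl, rfl, rfl, rfl⟩ := h
              refine ⟨L, L', by simp, by simp [hr], rfl, rfl, hn, fun _ => hxa, ?_, ?_, ?_⟩
              · intro i' hi'; omega
              · intro _; simp
              · intro hh; simp at hh
  | L :: t, i + 1, xa, ls', c, Ahi, Blo, h => by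
      simp only [stepAt] at h
      rcases hs : stepAt T t i L.x with _ | ⟨t', d⟩
      · rw [hs] at h; simp at h
      · rw [hs] at h
        obtain ⟨c', Ahi', Blo'⟩ := d
        simp only [Option.some.injEq, Prod.mk.injEq] at h
        obtain ⟨rfl, rfl, rfl, rfl⟩ := h
        obtain ⟨L₀, L', hL₀, hc, hA, hB, hn, h0, hsucc, hreal, hvirt⟩ := stepAt_spec T t i L.x t' c' Ahi' Blo' hs
        refine ⟨L₀, L', by simpa using hL₀, hc, hA, hB, hn, fun hh => absurd hh (by omega), ?_, ?_, ?_⟩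
        · intro i' hi' M hM
          have hi : i = i' := by omega
          subst hi
          cases i with
          | zero =>
            simp at hM
            subst hM
            exact h0 rfl
          | succ k =>
            exact hsucc k rfl M (by simpa using hM)
        · intro hh
          simp only [List.length_cons] at hh
          rw [hreal (by omega)]
          simp
        · intro hh
          simp only [List.length_cons] at hh
          obtain ⟨V, hV, ht'⟩ := hvirt (by omega)
          exact ⟨V, hV, by rw [ht']; simp⟩

end Checks

/-! ## Part 8: the semantic step -/

section StepCore


variable {T : List ℕ} {tmax X : ℕ}

/-- **The invariant** of a compact state `d` (relative to the table `T` and the target `X`).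
[folklore] -/
structure Inv (T : List ℕ) (X : ℕ) (d : SD) : Prop where
  /-- there is at least level `1` -/
  ne : d.xs ≠ []
  /-- thresholds are non-increasing -/
  sorted : d.xs.Pairwise (· ≥ ·)
  /-- thresholds are `≥ 2` -/
  two_le : ∀ x ∈ d.xs, 2 ≤ x
  /-- level `1` has a candidate -/
  top : after (d.xs.head ne) T ≠ []
  /-- `ε > 0` -/
  e_pos : 0 < d.e
  /-- every threshold entered its level with ratio `≥ 1` at the current `ε` -/
  up : CondUp d.xs ((d.e : ℝ) / 2 ^ 80)
  /-- `Llo ≤ 2⁸⁰ log N` -/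
  Llo_le : (d.Llo : ℝ) ≤ 2 ^ 80 * Lreal T d.xs
  /-- `2⁸⁰ S ≤ Shi` -/
  S_le : 2 ^ 80 * Sreal T d.xs ≤ d.Shi
  /-- `lll ≤ 2⁸⁰ log log log N` -/
  lll_le : (d.lll : ℝ) ≤ 2 ^ 80 * Real.log (Real.log (Lreal T d.xs))
  /-- `2⁸⁰ Θ_T(x₁) ≤ T1hi` -/
  T1 : 2 ^ 80 * ThT T (d.xs.head ne) ≤ d.T1hi
  /-- the frozen value bounds `2⁸⁰ θ(p)` for every prime `p < X` -/
  ThX_spec : ∀ v, d.ThX = some v → ∀ p : ℕ, p.Prime → p < X → 2 ^ 80 * Chebyshev.theta p ≤ v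
  /-- `N ≥ 55440` -/
  N_ge : 55440 ≤ Nnat T d.xs
  /-- Robin's inequality for `5040 < n ≤ N` -/
  robin : ∀ n : ℕ, 5040 < n → n ≤ Nnat T d.xs → robinInequality n

/-- Setting one entry of a non-increasing list to a value between its neighbours keeps it
non-increasing. [folklore] -/
theorem pairwise_ge_set {xs : List ℕ} (hs : xs.Pairwise (· ≥ ·)) {p c : ℕ} (hp : p < xs.length)
    (hlo : xs[p] ≤ c) (hhi : ∀ i : ℕ, (hi : i < p) → c ≤ xs[i]'(hi.trans hp)) :
    (xs.set p c).Pairwise (· ≥ ·) := by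
  rw [List.pairwise_iff_getElem] at hs ⊢
  intro i j hi hj hij
  simp only [List.length_set] at hi hj
  simp only [List.getElem_set]
  split_ifs with h1 h2 h2
  · omega
  · -- `i = p < j`: `c ≥ xs[p] ≥ xs[j]`
    subst h1
    exact le_trans (hs p j hp hj hij) hlo
  · -- `i < p = j`
    subst h2
    exact hhi i hij
  · exact hs i j hi hj hij

/-- **The semantic step.** Stepping position `p ≤ K` (the level `p+1`; `p = K` is the virtual
level) to its candidate `c = succT T (xsV xs p)` with a new `ε' = e/2⁸⁰ ≤ ε` at which `c` has ratio
`≥ 1`, given the ratio tests of the new state, the nesting condition, the numeric bounds of the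
increments and a successful `robinChk`, preserves the invariant. [folklore] -/
theorem step_core (hT : TableOK T tmax) {d : SD} (hI : Inv T X d) {p : ℕ} (hpK : p ≤ d.xs.length)
    (hy : after (xsV d.xs p) T ≠ []) {c : ℕ} (hc : succT T (xsV d.xs p) = c)
    (hnest : ∀ hp : 0 < p, c ≤ d.xs[p - 1]'(by omega))
    {e : ℕ} (he0 : 0 < e) (hee : e ≤ d.e)
    (hupc : 1 ≤ ratioF ((e : ℝ) / 2 ^ 80) (c : ℝ) p)
    {Bc Bhc Ac : ℕ} (hBc : (Bc : ℝ) ≤ 2 ^ 80 * Real.log c)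
    (hBhc : 2 ^ 80 * Real.log c ≤ Bhc)
    (hAc : 2 ^ 80 * Areal c (p + 1) ≤ Ac)
    {xs' : List ℕ} (hxs' : xs' = if p < d.xs.length then d.xs.set p c else d.xs ++ [c])
    (htop' : p = 0 → after c T ≠ [])
    (hdown : CondDown T xs' ((e : ℝ) / 2 ^ 80))
    {lll' : ℕ} (hchk : robinChk (d.Shi + Ac) e Bc d.Llo (d.Llo + Bc) d.lll = some lll')
    {T1hi' : ℕ} (hT1hi' : T1hi' = if p = 0 then d.T1hi + Bhc else d.T1hi)
    {ThX' : Option ℕ} (hThX' : ThX' = d.ThX ∨ (p = 0 ∧ X ≤ c ∧ ThX' = some T1hi'))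
    {d' : SD} (h'xs : d'.xs = xs') (h'L : d'.Llo = d.Llo + Bc) (h'S : d'.Shi = d.Shi + Ac) (h'e : d'.e = e)
    (h'lll : d'.lll = lll') (h'T1 : d'.T1hi = T1hi') (h'ThX : d'.ThX = ThX') :
    Inv T X d' := by
  classical
  obtain ⟨d'xs, d'L, d'S, d'e, d'lll, d'T1, d'ThX⟩ := d'
  simp only at h'xs h'L h'S h'e h'lll h'T1 h'ThX
  subst d'xs d'L d'S d'e d'lll d'T1 d'ThX
  have hnd : T.Nodup := hT.sorted.imp ne_of_lt
  have hK0 : 0 < d.xs.length := List.length_pos_of_ne_nil hI.ne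
  obtain ⟨hcT, hyc, hcmin⟩ := succT_spec hT.sorted hy
  rw [hc] at hcT hyc hcmin
  have hc2 : 2 ≤ c := hT.two_le c hcT
  have hc1R : (1 : ℝ) ≤ c := by exact_mod_cast le_trans (by norm_num) hc2
  have hct : c ≤ tmax := hT.bounded c hcT
  have hεε : (e : ℝ) / 2 ^ 80 ≤ (d.e : ℝ) / 2 ^ 80 := by
    apply div_le_div_of_nonneg_right _ (by positivity); exact_mod_cast hee
  have hε'0 : (0 : ℝ) ≤ (e : ℝ) / 2 ^ 80 := by positivity
  -- the head of `d.xs`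
  obtain ⟨x1, xt, hx1⟩ := List.exists_cons_of_ne_nil hI.ne
  have hxs0 : d.xs[0] = x1 := by simp [hx1]
  have hhead : d.xs.head hI.ne = x1 := by simp [hx1]
  -- (b) the exponent update on `T`
  have hexpo : ∀ q ∈ T, expo xs' q = expo d.xs q + (if q = c then 1 else 0) := by
    intro q hqT
    have hq2 := hT.two_le q hqT
    by_cases hp : p < d.xs.length
    · rw [hxs', if_pos hp]
      have hyp : (xsV d.xs p) = d.xs[p] := by rw [xsV_of_lt hp]
      have hset := expo_set d.xs p hp c q
      rw [← hyp] at hset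
      by_cases hqc : q = c
      · subst hqc
        rw [if_pos rfl]
        rw [if_neg (by omega), if_pos le_rfl] at hset
        omega
      · rw [if_neg hqc]
        have hiff : (q ≤ (xsV d.xs p) ↔ q ≤ c) := by
          constructor
          · intro h; omega
          · intro h
            by_contra hh
            push Not at hh
            have := hcmin q hqT hh
            omega
        by_cases hqy : q ≤ (xsV d.xs p)
        · rw [if_pos hqy, if_pos (hiff.1 hqy)] at hset; omega
        · rw [if_neg hqy, if_neg (fun h => hqy (hiff.2 h))] at hset; omega
    · have hpK' : p = d.xs.length := by omega
      rw [hxs', if_neg hp, expo_append_singleton]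
      -- here `(xsV d.xs p) = 1` and `c = 2`
      have hy1 : (xsV d.xs p) = 1 := by rw [hpK', xsV_length]
      have hc2' : c = 2 := by
        have := hcmin 2 hT.two_mem (by omega)
        omega
      by_cases hqc : q = c
      · rw [if_pos hqc.le, if_pos hqc]
      · rw [if_neg (by omega), if_neg hqc]
  -- (c) `expo d.xs c = p`
  have hexpoc : expo d.xs c = p := by
    apply le_antisymm
    · by_cases hp : p < d.xs.length
      · by_contra hh
        push Not at hh
        have := (expo_initial d.xs hI.sorted c p hp).2 (by omega)
        rw [← xsV_of_lt hp] at this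
        omega
      · have := expo_le_length d.xs c; omega
    · rcases Nat.eq_zero_or_pos p with hp0 | hp0
      · omega
      · have h1 := hnest hp0
        have := (expo_initial d.xs hI.sorted c (p - 1) (by omega)).1 h1
        omega
  -- (d) the sums
  have hL' : Lreal T xs' = Lreal T d.xs + Real.log c := by
    unfold Lreal
    rw [sum_map_update hnd hcT (fun q => (expo d.xs q : ℝ) * Real.log q)
      (fun q => (expo xs' q : ℝ) * Real.log q)]
    · rw [hexpo c hcT, if_pos rfl]; push_cast; ring
    · intro q hqT hqc; rw [hexpo q hqT, if_neg hqc, add_zero]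
  have hS' : Sreal T xs' = Sreal T d.xs + Areal c (p + 1) := by
    unfold Sreal
    rw [sum_map_update hnd hcT (fun q => Real.log (gsum q (expo d.xs q)) - (expo d.xs q : ℝ) * Real.log q)
      (fun q => Real.log (gsum q (expo xs' q)) - (expo xs' q : ℝ) * Real.log q)]
    · rw [hexpo c hcT, if_pos rfl, hexpoc]
      have hc0 : (0 : ℝ) < c := by linarith
      have hg1 : (1 : ℝ) ≤ gsum c p := by exact_mod_cast one_le_gsum c p
      unfold Areal
      rw [Nat.add_sub_cancel, gsum_succ_real]
      have e1 : (c : ℝ) * gsum c p + 1 = (c * gsum c p) * (1 + 1 / ((c : ℝ) * gsum c p)) := by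
        field_simp
      rw [e1, Real.log_mul (by positivity) (by positivity), Real.log_mul hc0.ne' (by positivity)]
      push_cast; ring
    · intro q hqT hqc; rw [hexpo q hqT, if_neg hqc, add_zero]
  have hN' : Nnat T xs' = Nnat T d.xs * c := by
    unfold Nnat
    apply prod_map_update hnd hcT
    · intro q hqT hqc; rw [hexpo q hqT, if_neg hqc, add_zero]
    · rw [hexpo c hcT, if_pos rfl, pow_succ]
  -- the head of `xs'` and `ThT`
  have hxs'ne : xs' ≠ [] := by
    rw [hxs']; split_ifs
    · simpa using hI.ne
    · simp
  have hhead' : xs'.head hxs'ne = if p = 0 then c else x1 := by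
    rw [List.head_eq_getElem]
    by_cases hp0 : p = 0
    · rw [if_pos hp0]
      have hv : xs' = d.xs.set 0 c := by rw [hxs', if_pos (by omega), hp0]
      subst hv
      simp
    · rw [if_neg hp0]
      by_cases hp : p < d.xs.length
      · have hv : xs' = d.xs.set p c := by rw [hxs', if_pos hp]
        subst hv
        simp [hp0, hxs0]
      · have hv : xs' = d.xs ++ [c] := by rw [hxs', if_neg hp]
        subst hv
        rw [List.getElem_append_left hK0]; exact hxs0
  have hTh' : ThT T (xs'.head hxs'ne) = ThT T x1 + (if p = 0 then Real.log c else 0) := by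
    rw [hhead']
    by_cases hp0 : p = 0
    · rw [if_pos hp0, if_pos hp0]
      have hy1 : (xsV d.xs p) = x1 := by rw [hp0, xsV_of_lt hK0, hxs0]
      unfold ThT
      rw [sum_map_update hnd hcT (fun q => if q ≤ x1 then Real.log q else 0)
        (fun q => if q ≤ c then Real.log q else 0)]
      · rw [if_pos le_rfl, if_neg (by omega)]; ring
      · intro q hqT hqc
        have hiff : (q ≤ x1 ↔ q ≤ c) := by
          rw [← hy1]
          constructor
          · intro h; omega
          · intro h
            by_contra hh
            push Not at hh
            have := hcmin q hqT hh
            omega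
        by_cases h : q ≤ x1
        · rw [if_pos h, if_pos (hiff.1 h)]
        · rw [if_neg h, if_neg (fun hh => h (hiff.2 hh))]
    · rw [if_neg hp0, if_neg hp0, add_zero]
  -- positivity facts on `N`
  have hNpos := Nnat_pos hT.two_le d.xs
  have hN3 : 3 ≤ Nnat T d.xs := le_trans (by norm_num) hI.N_ge
  have hLN : Real.log (Nnat T d.xs : ℕ) = Lreal T d.xs := log_Nnat hT.two_le d.xs
  have hLN' : Real.log (Nnat T xs' : ℕ) = Lreal T xs' := log_Nnat hT.two_le xs'
  have hL1 : 1 < Lreal T d.xs := by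
    rw [← hLN]
    have h3 : (3 : ℝ) ≤ (Nnat T d.xs : ℕ) := by exact_mod_cast hN3
    have := Real.exp_one_lt_d9
    rw [Real.lt_log_iff_exp_lt (by positivity)]
    linarith
  have hlogc0 : 0 ≤ Real.log c := Real.log_nonneg hc1R
  have hLle : Lreal T d.xs ≤ Lreal T xs' := by rw [hL']; linarith
  have hmono : Real.log (Real.log (Lreal T d.xs)) ≤ Real.log (Real.log (Lreal T xs')) := by
    apply Real.log_le_log (Real.log_pos hL1)
    exact Real.log_le_log (by linarith) hLle
  -- the envelope at the new state
  have hsorted' : xs'.Pairwise (· ≥ ·) := by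
    by_cases hp : p < d.xs.length
    · rw [hxs', if_pos hp]
      apply pairwise_ge_set hI.sorted hp
      · rw [← xsV_of_lt hp]; exact hyc.le
      · intro i hi
        rcases Nat.eq_zero_or_pos p with hp0 | hp0
        · omega
        · have h1 := hnest hp0
          have hs := List.pairwise_iff_getElem.1 hI.sorted
          rcases Nat.lt_or_ge i (p - 1) with hlt | hge
          · exact le_trans h1 (hs i (p - 1) (by omega) (by omega) hlt)
          · have : i = p - 1 := by omega
            subst this; exact h1
    · rw [hxs', if_neg hp, List.pairwise_append]
      refine ⟨hI.sorted, List.pairwise_singleton _ _, ?_⟩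
      intro a ha b hb
      simp only [List.mem_singleton] at hb
      subst hb
      -- `c = 2 ≤ a`
      have hpK' : p = d.xs.length := by omega
      have hy1 : (xsV d.xs p) = 1 := by rw [hpK', xsV_length]
      have := hcmin 2 hT.two_mem (by omega)
      have := hI.two_le a ha
      omega
  have htwo' : ∀ x ∈ xs', 2 ≤ x := by
    intro x hx
    rw [hxs'] at hx
    split_ifs at hx
    · rcases List.mem_or_eq_of_mem_set hx with h | h
      · exact hI.two_le x h
      · rw [h]; exact hc2
    · rw [List.mem_append, List.mem_singleton] at hx
      rcases hx with h | h
      · exact hI.two_le x h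
      · rw [h]; exact hc2
  have htopnew : after (xs'.head hxs'ne) T ≠ [] := by
    rw [hhead']
    by_cases hp0 : p = 0
    · rw [if_pos hp0]; exact htop' hp0
    · rw [if_neg hp0]; rw [← hhead]; exact hI.top
  have hup' : CondUp xs' ((e : ℝ) / 2 ^ 80) := by
    intro j hj
    by_cases hp : p < d.xs.length
    · have hxs'v : xs' = d.xs.set p c := by rw [hxs', if_pos hp]
      subst hxs'v
      simp only [List.getElem_set]
      split_ifs with hjp
      · subst hjp; exact hupc
      · simp only [List.length_set] at hj
        have h2 := hI.two_le _ (List.getElem_mem (l := d.xs) (n := j) hj)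
        exact le_trans (hI.up j hj) (ratioF_antitone_eps hεε (by exact_mod_cast le_trans (by norm_num) h2) j)
    · have hpK' : p = d.xs.length := by omega
      have hxs'v : xs' = d.xs ++ [c] := by rw [hxs', if_neg hp]
      subst hxs'v
      simp only [List.length_append, List.length_singleton] at hj
      rcases Nat.lt_or_ge j d.xs.length with hjK | hjK
      · rw [List.getElem_append_left hjK]
        have h2 := hI.two_le _ (List.getElem_mem (l := d.xs) (n := j) hjK)
        exact le_trans (hI.up j hjK) (ratioF_antitone_eps hεε (by exact_mod_cast le_trans (by norm_num) h2) j)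
      · have hjK' : j = d.xs.length := by omega
        simp only [hjK', List.getElem_concat_length]
        rw [← hpK']; exact hupc
  have henv : ∀ m : ℕ, 1 ≤ m → Nat.sigmaRpow ((e : ℝ) / 2 ^ 80) m ≤ Real.exp (Sreal T xs' - ((e : ℝ) / 2 ^ 80) * Lreal T xs') :=
    fun m hm => envelope hT hsorted' hxs'ne (fun x hx => le_trans (by norm_num) (htwo' x hx)) htopnew
      hε'0 hup' hdown hm
  -- Robin checks
  have hSb : 2 ^ 80 * Sreal T xs' ≤ ((d.Shi + Ac : ℕ) : ℝ) := by
    rw [hS']; push_cast; linarith [hI.S_le]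
  have hLlob : ((d.Llo + Bc : ℕ) : ℝ) ≤ 2 ^ 80 * Lreal T xs' := by
    rw [hL']; push_cast; linarith [hI.Llo_le]
  obtain ⟨hlll', h1, h2⟩ := robinChk_sound hchk (S' := Sreal T xs') (lc := Real.log c)
    (LN := Lreal T d.xs) (LN' := Lreal T xs') hSb hBc hI.Llo_le hLlob hI.lll_le hmono
  -- Robin on `[N, N c]`
  have hrobin' : ∀ n : ℕ, 5040 < n → n ≤ Nnat T xs' → robinInequality n := by
    intro n hn5 hnN'
    rcases le_or_gt n (Nnat T d.xs) with hle | hlt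
    · exact hI.robin n hn5 hle
    · refine robin_of_envelope hε'0 hN3 henv ?_ ?_ hlt.le hnN'
      · rw [Real.log_exp, hLN', hL'] at *
        have : Sreal T xs' - ((e : ℝ) / 2 ^ 80) * (Lreal T d.xs + Real.log c) + ((e : ℝ) / 2 ^ 80) * (Lreal T d.xs + Real.log c) = Sreal T xs' := by ring
        rw [hLN', hL', this]; rw [hL'] at h1; exact h1
      · rw [Real.log_exp, hLN]
        have : Sreal T xs' - ((e : ℝ) / 2 ^ 80) * Lreal T xs' + ((e : ℝ) / 2 ^ 80) * Lreal T d.xs = Sreal T xs' - ((e : ℝ) / 2 ^ 80) * Real.log c := by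
          rw [hL']; ring
        rw [this]; exact h2
  -- assemble
  refine ⟨hxs'ne, hsorted', htwo', htopnew, he0, hup', hLlob, hSb, ?_, ?_, ?_, ?_, hrobin'⟩
  · exact hlll'
  · -- `T1hi'`
    rw [hTh', hT1hi']
    have := hI.T1
    rw [hhead] at this
    split_ifs with hp0
    · push_cast; linarith
    · simpa using this
  · -- `ThX'`
    intro v hv q hq hqX
    rcases hThX' with h | ⟨hp0, hXc, h⟩
    · rw [h] at hv; exact hI.ThX_spec v hv q hq hqX
    · rw [h] at hv
      simp only [Option.some.injEq] at hv
      subst hv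
      rw [hT1hi', if_pos hp0]
      -- `2⁸⁰ θ(q) ≤ 2⁸⁰ Θ_T(c) ≤ T1hi + Bhc`
      have hth : Chebyshev.theta q ≤ ThT T c := by
        apply theta_le_ThT hT.sorted hT.two_le
        intro p' hp' hp'q
        have hp'q' : p' ≤ q := by exact_mod_cast hp'q
        have hp'c : p' ≤ c := by omega
        exact ⟨hT.complete p' hp' (hp'c.trans hct), hp'c⟩
      have hThc : ThT T c = ThT T x1 + Real.log c := by
        have := hTh'; rw [hhead', if_pos hp0, if_pos hp0] at this; exact this
      have := hI.T1
      rw [hhead] at this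
      rw [hThc] at hth
      push_cast
      nlinarith
  · -- `N ≥ 55440`
    rw [hN']; exact le_trans hI.N_ge (Nat.le_mul_of_pos_right _ (by omega))

end StepCore

/-! ## Part 9: well-formed expanded states, the step and the run -/

section RunSound


variable {T : List ℕ} {tmax X : ℕ}

/-- Well-formedness of an expanded state (validity of the cached level data and agreement of the
cursors with the table). [folklore] -/
structure WF (T : List ℕ) (s : St) : Prop where
  /-- level 1 data valid -/
  l1v : s.l1.Valid
  /-- level 1 has index 1 -/
  l1j : s.l1.j = 1
  /-- level 1 cursor -/
  l1r : s.l1.rest = after s.l1.x T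
  /-- further levels valid -/
  lsv : ∀ L ∈ s.ls, L.Valid
  /-- indices of the further levels -/
  lsj : ∀ (i : ℕ) (hi : i < s.ls.length), s.ls[i].j = i + 2
  /-- cursors of the further levels -/
  lsr : ∀ L ∈ s.ls, L.rest = after L.x T
  /-- there is a virtual level -/
  lsne : s.ls ≠ []
  /-- the last level is the virtual one (threshold `1`) -/
  vx : (s.ls.getLast lsne).x = 1
  /-- `nmx` bounds the `need`s of the further levels -/
  nmx : ∀ L ∈ s.ls, L.need ≤ s.nmx

/-- The candidate of a level whose cursor agrees with the table is the table successor of its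
threshold. [folklore] -/
theorem cand_eq_succT {L : Level} (h : L.rest = after L.x T) : L.cand = succT T L.x := by
  simp [Level.cand, succT, h]

/-- The thresholds of `compress s`: length. [folklore] -/
theorem length_compress_xs (s : St) (hne : s.ls ≠ []) : (compress s).xs.length = s.ls.length := by
  have := List.length_pos_of_ne_nil hne
  simp [compress]; omega

/-- The thresholds of `compress s`: entries `1 ≤ i+1 < K` come from `ls`. [folklore] -/
theorem getElem_compress_xs_succ (s : St) {i : ℕ} (hi : i + 1 < (compress s).xs.length) :
    (compress s).xs[i + 1] = (s.ls[i]'(by simp [compress] at hi; omega)).x := by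
  simp [compress]

/-- The first threshold of a compressed state is level `1`'s. [folklore] -/
theorem getElem_compress_xs_zero (s : St) (h : 0 < (compress s).xs.length) :
    (compress s).xs[0] = s.l1.x := by
  simp [compress]

/-- `xsV` of the compressed thresholds at the last position is the virtual threshold. [folklore] -/
theorem xsV_compress_last (s : St) (hW : WF T s) :
    xsV (compress s).xs s.ls.length = 1 := by
  rw [← length_compress_xs s hW.lsne, xsV_length]

/-- **`CondDown` from the `need` checks.** [folklore] -/
theorem condDown_of_WF {s : St} (hW : WF T s) {e : ℕ} (h1 : s.l1.need ≤ e) (hn : s.nmx ≤ e) :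
    CondDown T (compress s).xs ((e : ℝ) / 2 ^ 80) := by
  intro j hj
  have hKl := length_compress_xs s hW.lsne
  have hls := List.length_pos_of_ne_nil hW.lsne
  rcases j with _ | i
  · -- level 1
    have h0 : 0 < (compress s).xs.length := by omega
    rw [xsV_of_lt h0, getElem_compress_xs_zero s h0, ← cand_eq_succT hW.l1r]
    have := hW.l1v.ratioF_le_one h1
    rwa [hW.l1j] at this
  · -- level `i+2` = `ls[i]`, `i < ls.length`
    have hi : i < s.ls.length := by have := hj; rw [hKl] at this; omega
    have hLmem : s.ls[i] ∈ s.ls := List.getElem_mem _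
    have hx : xsV (compress s).xs (i + 1) = (s.ls[i]).x := by
      rcases Nat.lt_or_ge (i + 1) s.ls.length with hlt | hge
      · rw [xsV_of_lt (by omega), getElem_compress_xs_succ]
      · have hiK : i + 1 = s.ls.length := by omega
        rw [hiK, xsV_compress_last s hW]
        have hlast := hW.vx
        rw [List.getLast_eq_getElem] at hlast
        have hidx : s.ls.length - 1 = i := by omega
        simp only [hidx] at hlast
        exact hlast.symm
    rw [hx, ← cand_eq_succT (hW.lsr _ hLmem)]
    have := (hW.lsv _ hLmem).ratioF_le_one ((hW.nmx _ hLmem).trans hn)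
    rwa [hW.lsj i hi, show i + 2 - 1 = i + 1 by omega] at this

/-- `mkLevelNext L = some L'` forces at least two cursor entries. [folklore] -/
theorem rest_of_mkLevelNext {L L' : Level} (h : mkLevelNext L = some L') :
    ∃ c c' t, L.rest = c :: c' :: t := by
  obtain ⟨Lj, Lx, Lrest, LBlo, LBhi, LAlo, LAhi, Lecrit, Lneed⟩ := L
  unfold mkLevelNext at h
  rcases Lrest with _ | ⟨c, _ | ⟨c', t⟩⟩
  · simp at h
  · simp at h
  · exact ⟨c, c', t, rfl⟩

/-- `(l.set i a).dropLast = l.dropLast.set i a`. [folklore] -/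
theorem dropLast_set {α : Type*} (l : List α) (i : ℕ) (a : α) :
    (l.set i a).dropLast = l.dropLast.set i a := by
  rw [List.dropLast_eq_take, List.dropLast_eq_take, List.length_set, List.take_set]

/-- Setting the last entry: `l.set (|l| − 1) a = l.dropLast ++ [a]`. [folklore] -/
theorem set_length_sub_one {α : Type*} {l : List α} (h : l ≠ []) (a : α) :
    l.set (l.length - 1) a = l.dropLast ++ [a] := by
  have hl := List.length_pos_of_ne_nil h
  rw [List.set_eq_take_append_cons_drop, if_pos (by omega), List.dropLast_eq_take,
    show l.length - 1 + 1 = l.length by omega, List.drop_of_length_le le_rfl]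

/-- **The cold step** (a further level `i+2`, or the virtual level, steps). [folklore] -/
theorem step_cold_sound (hT : TableOK T tmax) {l1 : Level} {ls : List Level} {mx nmx Llo Shi e0 lll T1hi : ℕ}
    {ThX : Option ℕ} (hW : WF T ⟨l1, ls, mx, nmx, Llo, Shi, e0, lll, T1hi, ThX⟩)
    (hI : Inv T X (compress ⟨l1, ls, mx, nmx, Llo, Shi, e0, lll, T1hi, ThX⟩))
    {i e xa : ℕ} (harg : argmax ls = (i, e)) (he0 : 0 < e) (hee : e ≤ e0) (hxa0 : i = 0 → xa = l1.x)
    {ls' : List Level} {c Ahi Blo mx' nmx' lll' : ℕ} (hst : stepAt T ls i xa = some (ls', c, Ahi, Blo))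
    (hmax : maxima ls' = (mx', nmx')) (hn1 : nmx' ≤ e) (hn2 : l1.need ≤ e)
    (hchk : robinChk (Shi + Ahi) e Blo Llo (Llo + Blo) lll = some lll') :
    WF T ⟨l1, ls', mx', nmx', Llo + Blo, Shi + Ahi, e, lll', T1hi, ThX⟩ ∧
      Inv T X (compress ⟨l1, ls', mx', nmx', Llo + Blo, Shi + Ahi, e, lll', T1hi, ThX⟩) := by
  have hnd : T.Nodup := hT.sorted.imp ne_of_lt
  obtain ⟨L, L', hL, hc, hA, hB, hn, h0, hsucc', hreal, hvirt⟩ := stepAt_spec T ls i xa ls' c Ahi Blo hst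
  obtain ⟨hi, hLi⟩ := List.getElem?_eq_some_iff.1 hL
  -- `e = L.ecrit`
  obtain ⟨L₀, hL₀, hL₀e⟩ := argmax_spec ls hW.lsne
  rw [harg] at hL₀ hL₀e
  simp only at hL₀ hL₀e
  rw [hL] at hL₀
  simp only [Option.some.injEq] at hL₀
  subst hL₀
  have hLe : L.ecrit = e := hL₀e
  -- facts on `L` from `WF`
  have hLmem : L ∈ ls := by rw [← hLi]; exact List.getElem_mem _
  have hLv : L.Valid := hW.lsv L hLmem
  have hLj : L.j = i + 2 := by rw [← hLi]; exact hW.lsj i hi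
  have hLr : L.rest = after L.x T := hW.lsr L hLmem
  obtain ⟨c₀, c', t, hLrest⟩ := rest_of_mkLevelNext hn
  rw [hLrest] at hc
  simp only [List.head?_cons, Option.some.injEq] at hc
  subst hc
  rw [hLrest] at hLr
  obtain ⟨hcT, hxc, hcmin⟩ := head_after hT.sorted hLr.symm
  have htail : c' :: t = after c₀ T := tail_after hT.sorted hLr.symm
  have hc'T : c' ∈ T := by
    have : c' ∈ after c₀ T := by rw [← htail]; simp
    exact ((mem_after hT.sorted).1 this).1
  obtain ⟨hV', hj', hx', hr'⟩ := mkLevelNext_valid hLv hLrest (hT.two_le c' hc'T) hn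
  have hcand : L.cand = c₀ := by simp [Level.cand, hLrest]
  have hc2 : 2 ≤ c₀ := hT.two_le _ hcT
  -- the new list of levels, in both cases
  have hls' : (i + 1 < ls.length ∧ ls' = ls.set i L') ∨
      (i + 1 = ls.length ∧ ∃ V : Level, V.Valid ∧ V.j = i + 3 ∧ V.x = 1 ∧ V.rest = T ∧
        ls' = ls.set i L' ++ [V]) := by
    rcases Nat.lt_or_ge (i + 1) ls.length with hlt | hge
    · exact Or.inl ⟨hlt, hreal hlt⟩
    · have heq : i + 1 = ls.length := by omega
      obtain ⟨V, hV, hls'⟩ := hvirt heq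
      obtain ⟨tt, hTt⟩ := List.head?_eq_some_iff.1 hT.head2
      rw [hTt] at hV
      obtain ⟨hVv, hVj, hVx, hVr⟩ := mkLevelB_valid (le_refl 2) (by omega) L2LON_le le_L2HIN hV
      refine Or.inr ⟨heq, V, hVv, by rw [hVj, hLj], hVx, by rw [hVr, hTt], hls'⟩
  -- well-formedness of the new state
  have hW' : WF T ⟨l1, ls', mx', nmx', Llo + Blo, Shi + Ahi, e, lll', T1hi, ThX⟩ := by
    have hlen : 0 < ls.length := List.length_pos_of_ne_nil hW.lsne
    rcases hls' with ⟨hlt, rfl⟩ | ⟨heq, V, hVv, hVj, hVx, hVr, rfl⟩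
    · refine ⟨hW.l1v, hW.l1j, hW.l1r, ?_, ?_, ?_, by simpa using hW.lsne, ?_, ?_⟩
      · intro M hM
        rcases List.mem_or_eq_of_mem_set hM with h | h
        · exact hW.lsv M h
        · rw [h]; exact hV'
      · intro k hk
        simp only [List.length_set] at hk
        simp only [List.getElem_set]
        split_ifs with hik
        · subst hik; rw [hj', hLj]
        · exact hW.lsj k hk
      · intro M hM
        rcases List.mem_or_eq_of_mem_set hM with h | h
        · exact hW.lsr M h
        · rw [h, hr', hx', htail]
      · show ((ls.set i L').getLast _).x = 1
        rw [List.getLast_eq_getElem]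
        have hlast := hW.vx
        simp only at hlast
        rw [List.getLast_eq_getElem] at hlast
        simp only [List.length_set]
        rw [List.getElem_set_ne (by omega)]
        exact hlast
      · intro M hM
        have := need_le_maxima _ M hM
        rw [hmax] at this
        exact this
    · refine ⟨hW.l1v, hW.l1j, hW.l1r, ?_, ?_, ?_, by simp, ?_, ?_⟩
      · intro M hM
        rw [List.mem_append, List.mem_singleton] at hM
        rcases hM with hM | hM
        · rcases List.mem_or_eq_of_mem_set hM with h | h
          · exact hW.lsv M h
          · rw [h]; exact hV'
        · rw [hM]; exact hVv
      · intro k hk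
        simp only [List.length_append, List.length_set, List.length_singleton] at hk
        rcases Nat.lt_or_ge k ls.length with hkl | hkl
        · rw [List.getElem_append_left (by simpa using hkl)]
          simp only [List.getElem_set]
          split_ifs with hik
          · subst hik; rw [hj', hLj]
          · exact hW.lsj k hkl
        · have hk' : k = ls.length := by omega
          subst hk'
          rw [List.getElem_append_right (by simp)]
          simp only [List.length_set, Nat.sub_self, List.getElem_cons_zero]
          rw [hVj]; omega
      · intro M hM
        rw [List.mem_append, List.mem_singleton] at hM
        rcases hM with hM | hM
        · rcases List.mem_or_eq_of_mem_set hM with h | h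
          · exact hW.lsr M h
          · rw [h, hr', hx', htail]
        · rw [hM, hVr, hVx]
          exact (after_eq_self (fun q hq => lt_of_lt_of_le one_lt_two (hT.two_le q hq))).symm
      · show ((ls.set i L' ++ [V]).getLast _).x = 1
        rw [List.getLast_append_of_ne_nil _ (by simp)]
        simpa using hVx
      · intro M hM
        have := need_le_maxima _ M hM
        rw [hmax] at this
        exact this
  refine ⟨hW', ?_⟩
  -- the semantic step at position `i+1`
  set xs := l1.x :: (ls.map Level.x).dropLast with hxs
  have hI' : Inv T X ⟨xs, Llo, Shi, e0, lll, T1hi, ThX⟩ := hI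
  have hKlen : xs.length = ls.length := by
    have := List.length_pos_of_ne_nil hW.lsne; simp [hxs]; omega
  -- `xsV xs (i+1) = L.x`
  have hyx : xsV xs (i + 1) = L.x := by
    rcases Nat.lt_or_ge (i + 1) ls.length with hlt | hge
    · rw [xsV_of_lt (by omega)]
      simp only [hxs, List.getElem_cons_succ, List.getElem_dropLast, List.getElem_map]
      rw [hLi]
    · have heq : i + 1 = xs.length := by omega
      rw [heq, xsV_length]
      have hlast := hW.vx
      simp only at hlast
      rw [List.getLast_eq_getElem] at hlast
      have hidx : ls.length - 1 = i := by omega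
      simp only [hidx] at hlast
      rw [hLi] at hlast
      exact hlast.symm
  have hsucc : succT T (xsV xs (i + 1)) = c₀ := by
    rw [hyx, succT, ← hW.lsr L hLmem, hLrest]; rfl
  have hupc := hLv.one_le_ratioF (le_refl L.ecrit)
  rw [hcand, hLj, show i + 2 - 1 = i + 1 by omega, hLe] at hupc
  have hBc := hLv.hBlo; rw [hcand] at hBc
  have hBhc := hLv.hBhi; rw [hcand] at hBhc
  have hAc := hLv.hAhi; rw [hcand, hLj] at hAc
  -- the new thresholds
  have hxs'c : (compress ⟨l1, ls', mx', nmx', Llo + Blo, Shi + Ahi, e, lll', T1hi, ThX⟩).xs =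
      (if i + 1 < xs.length then xs.set (i + 1) c₀ else xs ++ [c₀]) := by
    rcases hls' with ⟨hlt, rfl⟩ | ⟨heq, V, hVv, hVj, hVx, hVr, rfl⟩
    · rw [if_pos (by omega)]
      simp only [compress, hxs, List.map_set, hx', List.set_cons_succ]
      rw [dropLast_set]
    · rw [if_neg (by omega)]
      simp only [compress, hxs, List.map_append, List.map_set, hx', List.map_cons, List.map_nil,
        List.dropLast_concat, List.cons_append]
      congr 1
      have hne : ls.map Level.x ≠ [] := by simpa using hW.lsne
      have := set_length_sub_one hne c₀
      rw [List.length_map] at this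
      rw [← this]
      congr 1; omega
  have hdown := condDown_of_WF hW' hn2 hn1
  rw [hxs'c] at hdown
  refine step_core hT hI' (p := i + 1) (by show i + 1 ≤ xs.length; omega) ?_ hsucc ?_ he0 hee hupc
    (by rw [hB]; exact hBc) hBhc (by rw [hA]; exact hAc)
    (xs' := if i + 1 < xs.length then xs.set (i + 1) c₀ else xs ++ [c₀]) rfl
    (fun hp => absurd hp (Nat.succ_ne_zero i)) hdown hchk (T1hi' := T1hi) (by simp) (ThX' := ThX)
    (Or.inl rfl) hxs'c rfl rfl rfl rfl rfl rfl
  · -- the candidate exists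
    show after (xsV xs (i + 1)) T ≠ []
    rw [hyx, ← hW.lsr L hLmem, hLrest]; simp
  · -- nesting
    intro hp
    show c₀ ≤ xs[i + 1 - 1]
    simp only [Nat.add_sub_cancel]
    rcases i with _ | i'
    · have : xs[0] = l1.x := by simp [hxs]
      rw [this, ← hxa0 rfl]; exact h0 rfl
    · have hi' : i' < ls.length := by omega
      have : xs[i' + 1] = (ls[i']).x := by
        simp only [hxs, List.getElem_cons_succ, List.getElem_dropLast, List.getElem_map]
      rw [this]
      exact hsucc' i' rfl ls[i'] (List.getElem?_eq_getElem hi')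

/-- **Soundness of one step.** [folklore] -/
theorem step_sound (hT : TableOK T tmax) {s s' : St} (hW : WF T s) (hI : Inv T X (compress s))
    (h : step T X s = some s') : WF T s' ∧ Inv T X (compress s') := by
  obtain ⟨l1, ls, mx, nmx, Llo, Shi, e0, lll, T1hi, ThX⟩ := s
  obtain ⟨j1, x1, rest, Blo1, Bhi1, Alo1, Ahi1, ecrit1, need1⟩ := l1
  have hnd : T.Nodup := hT.sorted.imp ne_of_lt
  have hV1 : Level.Valid ⟨j1, x1, rest, Blo1, Bhi1, Alo1, Ahi1, ecrit1, need1⟩ := hW.l1v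
  have hj1 : j1 = 1 := hW.l1j
  have hr1 : rest = after x1 T := hW.l1r
  have hI' : Inv T X ⟨x1 :: (ls.map Level.x).dropLast, Llo, Shi, e0, lll, T1hi, ThX⟩ := hI
  have hK0 : 0 < (x1 :: (ls.map Level.x).dropLast).length := by simp
  unfold step at h
  simp only at h
  cases hhot : Nat.ble mx ecrit1 with
  | false =>
    -- ### cold path
    rw [hhot] at h
    simp only [cond_false] at h
    rcases harg : argmax ls with ⟨i, e⟩
    rw [harg] at h
    simp only at h
    cases hg1 : (Nat.beq e 0 || Nat.blt e0 e) with
    | true => rw [hg1] at h; simp at h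
    | false =>
    rw [hg1] at h
    simp only [cond_false] at h
    simp only [Bool.or_eq_false_iff] at hg1
    have he0 : 0 < e := Nat.pos_of_ne_zero fun hh => by simp [hh] at hg1
    have hee : e ≤ e0 := Nat.le_of_not_lt (blt_false hg1.2)
    -- name the `xa` argument
    -- split on the result of `stepAt`; its last argument (the threshold above the stepped level,
    -- a `match` on `i`) is then named `xa`, of which only `i = 0 → xa = x1` is used
    split at h
    · simp at h
    · rename_i ls' c Ahi Blo hst₀
      obtain ⟨xa, hst, hxa0⟩ :
          ∃ xa : ℕ, stepAt T ls i xa = some (ls', c, Ahi, Blo) ∧ (i = 0 → xa = x1) :=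
        ⟨_, hst₀, fun hi0 => by subst hi0; rfl⟩
      clear hst₀
      rcases hmax : maxima ls' with ⟨mx', nmx'⟩
      rw [hmax] at h
      simp only at h
      cases hg2 : (Nat.blt e nmx' || Nat.blt e need1) with
      | true => rw [hg2] at h; simp at h
      | false =>
      rw [hg2] at h
      simp only [cond_false] at h
      simp only [Bool.or_eq_false_iff] at hg2
      have hn1 : nmx' ≤ e := Nat.le_of_not_lt (blt_false hg2.1)
      have hn2 : need1 ≤ e := Nat.le_of_not_lt (blt_false hg2.2)
      cases hg3 : Nat.beq (Nat.add Llo Blo) 0 with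
      | true => rw [hg3] at h; simp at h
      | false =>
      rw [hg3] at h
      simp only [cond_false] at h
      rcases hchk : robinChk (Nat.add Shi Ahi) e Blo Llo (Nat.add Llo Blo) lll with _ | lll'
      · rw [hchk] at h; simp at h
      · rw [hchk] at h
        simp only [Option.some.injEq] at h
        subst h
        simp only [Nat.add_eq] at hchk
        exact step_cold_sound hT hW hI harg he0 hee hxa0 hst hmax hn1 hn2 hchk
  | true =>
    -- ### hot path
    rw [hhot] at h
    simp only [cond_true] at h
    cases hg1 : (Nat.beq ecrit1 0 || Nat.blt e0 ecrit1) with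
    | true => rw [hg1] at h; simp at h
    | false =>
    rw [hg1] at h
    simp only [cond_false] at h
    simp only [Bool.or_eq_false_iff] at hg1
    have he0 : 0 < ecrit1 := Nat.pos_of_ne_zero fun hh => by simp [hh] at hg1
    have hee : ecrit1 ≤ e0 := Nat.le_of_not_lt (blt_false hg1.2)
    rcases hrest : rest with _ | ⟨c, rtail⟩
    · rw [hrest] at h; simp at h
    · rw [hrest] at h
      simp only at h
      rcases hnext : mkLevelNext ⟨j1, x1, c :: rtail, Blo1, Bhi1, Alo1, Ahi1, ecrit1, need1⟩ with _ | l1'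
      · rw [hnext] at h; simp at h
      · rw [hnext] at h
        simp only at h
        cases hg2 : (Nat.blt ecrit1 l1'.need || Nat.blt ecrit1 nmx) with
        | true => rw [hg2] at h; simp at h
        | false =>
        rw [hg2] at h
        simp only [cond_false] at h
        simp only [Bool.or_eq_false_iff] at hg2
        have hneed1 : l1'.need ≤ ecrit1 := Nat.le_of_not_lt (blt_false hg2.1)
        have hnmx : nmx ≤ ecrit1 := Nat.le_of_not_lt (blt_false hg2.2)
        cases hg3 : (Nat.beq (Nat.add Llo Blo1) 0 || Nat.beq (Nat.add T1hi Bhi1) 0) with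
        | true => rw [hg3] at h; simp at h
        | false =>
        rw [hg3] at h
        simp only [cond_false] at h
        rcases hchk : robinChk (Nat.add Shi Ahi1) ecrit1 Blo1 Llo (Nat.add Llo Blo1) lll with _ | lll'
        · rw [hchk] at h; simp at h
        · rw [hchk] at h
          simp only [Option.some.injEq] at h
          have hs' := h.symm
          clear h
          simp only [Nat.add_eq] at hchk
          -- the second cursor entry
          obtain ⟨c₀, c', t, hcc⟩ := rest_of_mkLevelNext hnext
          simp only [List.cons.injEq] at hcc
          obtain ⟨rfl, rfl⟩ := hcc
          rw [hrest] at hr1 hV1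
          obtain ⟨hcT, hx1c, hcmin⟩ := head_after hT.sorted hr1.symm
          have htail : c' :: t = after c T := tail_after hT.sorted hr1.symm
          have hc'T : c' ∈ T := by
            have : c' ∈ after c T := by rw [← htail]; simp
            exact ((mem_after hT.sorted).1 this).1
          obtain ⟨hV1', hj1', hx1', hr1'⟩ := mkLevelNext_valid hV1 rfl (hT.two_le c' hc'T) hnext
          simp only at hj1'
          -- the new state is well formed
          have hW' : WF T s' := by
            rw [hs']
            exact { l1v := hV1'
                    l1j := by rw [hj1', hj1]
                    l1r := by show l1'.rest = after l1'.x T; rw [hr1', hx1', htail]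
                    lsv := hW.lsv
                    lsj := hW.lsj
                    lsr := hW.lsr
                    lsne := hW.lsne
                    vx := hW.vx
                    nmx := hW.nmx }
          refine ⟨hW', ?_⟩
          -- the semantic step at position `0`
          have hxsV0 : xsV (x1 :: (ls.map Level.x).dropLast) 0 = x1 := by rw [xsV_of_lt hK0]; rfl
          have hsucc : succT T (xsV (x1 :: (ls.map Level.x).dropLast) 0) = c := by
            rw [hxsV0, succT, ← hr1]; rfl
          have hcand : Level.cand ⟨j1, x1, c :: c' :: t, Blo1, Bhi1, Alo1, Ahi1, ecrit1, need1⟩ = c := rfl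
          have hupc := hV1.one_le_ratioF (le_refl ecrit1)
          rw [hcand] at hupc
          simp only [hj1] at hupc
          have hBc := hV1.hBlo; rw [hcand] at hBc
          have hBhc := hV1.hBhi; rw [hcand] at hBhc
          have hAc := hV1.hAhi; rw [hcand] at hAc
          simp only [hj1] at hAc hBc hBhc
          have hxs'c : (compress s').xs = (x1 :: (ls.map Level.x).dropLast).set 0 c := by
            rw [hs']; simp [compress, hx1']
          have hdown := condDown_of_WF hW' (e := ecrit1) (by rw [hs']; exact hneed1) (by rw [hs']; exact hnmx)
          rw [hxs'c] at hdown
          refine step_core hT hI' (p := 0) (Nat.zero_le _) ?_ hsucc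
            (fun hp => absurd hp (lt_irrefl 0)) he0 hee hupc hBc hBhc hAc
            (xs' := (x1 :: (ls.map Level.x).dropLast).set 0 c)
            ?_ (fun _ => by rw [← htail]; simp) hdown hchk (T1hi' := T1hi + Bhi1) (by simp)
            (ThX' := (compress s').ThX) ?_ hxs'c (by rw [hs']; rfl) (by rw [hs']; rfl) (by rw [hs']; rfl)
            (by rw [hs']; rfl) (by rw [hs']; rfl) rfl
          · show after (xsV (x1 :: (ls.map Level.x).dropLast) 0) T ≠ []
            rw [hxsV0, ← hr1]; simp
          · show (x1 :: (ls.map Level.x).dropLast).set 0 c =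
              if 0 < (x1 :: (ls.map Level.x).dropLast).length then (x1 :: (ls.map Level.x).dropLast).set 0 c
              else (x1 :: (ls.map Level.x).dropLast) ++ [c]
            rw [if_pos hK0]
          · -- `ThX'`
            rw [hs']
            simp only [compress]
            cases ThX with
            | some v => exact Or.inl rfl
            | none =>
              cases hXc : Nat.ble X c with
              | true => exact Or.inr ⟨trivial, ble_true hXc, by simp⟩
              | false => exact Or.inl (by simp)

/-- **Soundness of `run`.** [folklore] -/
theorem run_sound (hT : TableOK T tmax) {U : ℕ} : ∀ (fuel : ℕ) {s s' : St}, WF T s → Inv T X (compress s) →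
    run T X U fuel s = some s' → WF T s' ∧ Inv T X (compress s')
  | 0, s, s', hW, hI, h => by
      simp only [run, Option.some.injEq] at h
      subst h; exact ⟨hW, hI⟩
  | fuel + 1, s, s', hW, hI, h => by
      simp only [run] at h
      cases hd : done U s with
      | true =>
        rw [hd] at h
        simp only [cond_true, Option.some.injEq] at h
        subst h; exact ⟨hW, hI⟩
      | false =>
        rw [hd] at h
        simp only [cond_false] at h
        rcases hs : step T X s with _ | s₁
        · rw [hs] at h; simp at h
        · rw [hs] at h
          simp only at h
          obtain ⟨hW₁, hI₁⟩ := step_sound hT hW hI hs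
          exact run_sound hT fuel hW₁ hI₁ h

/-- **Specification of `mkLevels`.** [folklore] -/
theorem mkLevels_spec (hT : TableOK T tmax) : ∀ (xs : List ℕ) (j : ℕ) (ls : List Level), 1 ≤ j →
    mkLevels T j xs = some ls →
    (∀ L ∈ ls, L.Valid) ∧ (∀ (k : ℕ) (hk : k < ls.length), ls[k].j = j + k) ∧
      (∀ L ∈ ls, L.rest = after L.x T) ∧ ls.map Level.x = xs ++ [1]
  | [], j, ls, hj, h => by
      simp only [mkLevels, Option.map_eq_some_iff] at h
      obtain ⟨V, hV, rfl⟩ := h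
      obtain ⟨tt, hTt⟩ := List.head?_eq_some_iff.1 hT.head2
      rw [hTt] at hV
      obtain ⟨hVv, hVj, hVx, hVr⟩ := mkLevelB_valid (le_refl 2) hj L2LON_le le_L2HIN hV
      refine ⟨by simpa using hVv, ?_, ?_, by simp [hVx]⟩
      · intro k hk
        simp only [List.length_singleton] at hk
        have : k = 0 := by omega
        subst this
        simpa using hVj
      · intro L hL
        simp only [List.mem_singleton] at hL
        subst hL
        rw [hVr, hVx, ← hTt]
        exact (after_eq_self (fun q hq => lt_of_lt_of_le one_lt_two (hT.two_le q hq))).symm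
  | x :: xt, j, ls, hj, h => by
      simp only [mkLevels] at h
      rcases hF : mkLevelFull j x (after x T) with _ | L
      · rw [hF] at h; simp at h
      · rw [hF] at h
        rcases hM : mkLevels T (j + 1) xt with _ | t'
        · rw [hM] at h; simp at h
        · rw [hM] at h
          simp only [Option.some.injEq] at h
          subst h
          obtain ⟨ihv, ihj, ihr, ihx⟩ := mkLevels_spec hT xt (j + 1) t' (by omega) hM
          -- the cursor of the new level
          rcases ha : after x T with _ | ⟨c, r⟩
          · rw [ha] at hF; simp [mkLevelFull] at hF
          · rw [ha] at hF
            obtain ⟨hcT, -, -⟩ := head_after hT.sorted ha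
            obtain ⟨hLv, hLj, hLx, hLr⟩ := mkLevelFull_valid (hT.two_le c hcT) hj hF
            refine ⟨?_, ?_, ?_, ?_⟩
            · intro M hM
              rcases List.mem_cons.1 hM with rfl | hM
              · exact hLv
              · exact ihv M hM
            · intro k hk
              rcases k with _ | k
              · simpa using hLj
              · simp only [List.getElem_cons_succ]
                rw [ihj k (by simpa using hk)]; omega
            · intro M hM
              rcases List.mem_cons.1 hM with rfl | hM
              · rw [hLr, hLx, ha]
              · exact ihr M hM
            · simp [hLx, ihx]

/-- **Specification of `expand`**: an expanded state is well formed and compresses back. [folklore] -/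
theorem expand_spec (hT : TableOK T tmax) {d : SD} {s : St} (h : expand T d = some s) :
    WF T s ∧ compress s = d := by
  obtain ⟨xs, Llo, Shi, e, lll, T1hi, ThX⟩ := d
  unfold expand at h
  simp only at h
  rcases xs with _ | ⟨x1, xt⟩
  · simp at h
  · simp only at h
    rcases hF : mkLevelFull 1 x1 (after x1 T) with _ | l1
    · rw [hF] at h; simp at h
    · rw [hF] at h
      rcases hM : mkLevels T 2 xt with _ | ls
      · rw [hM] at h; simp at h
      · rw [hM] at h
        simp only at h
        rcases hmx : maxima ls with ⟨mx, nmx⟩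
        rw [hmx] at h
        simp only [Option.some.injEq] at h
        subst h
        obtain ⟨lsv, lsj, lsr, lsx⟩ := mkLevels_spec hT xt 2 ls (by norm_num) hM
        rcases ha : after x1 T with _ | ⟨c, r⟩
        · rw [ha] at hF; simp [mkLevelFull] at hF
        · rw [ha] at hF
          obtain ⟨hcT, -, -⟩ := head_after hT.sorted ha
          obtain ⟨hLv, hLj, hLx, hLr⟩ := mkLevelFull_valid (hT.two_le c hcT) le_rfl hF
          have hne : ls ≠ [] := by
            intro hh; rw [hh] at lsx; simp at lsx
          have hW : WF T ⟨l1, ls, mx, nmx, Llo, Shi, e, lll, T1hi, ThX⟩ :=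
            { l1v := hLv
              l1j := hLj
              l1r := by show l1.rest = after l1.x T; rw [hLr, hLx, ha]
              lsv := lsv
              lsj := fun k hk => by rw [lsj k hk]; omega
              lsr := lsr
              lsne := hne
              vx := by
                show (ls.getLast hne).x = 1
                rw [← List.getLast_map (f := Level.x) (by simpa using hne)]
                simp only [lsx]
                exact List.getLast_concat
              nmx := fun L hL => by have := need_le_maxima ls L hL; rw [hmx] at this; exact this }
          refine ⟨hW, ?_⟩
          simp only [compress, hLx, lsx, List.dropLast_concat]

/-- **Soundness of a chunk**: `runD` preserves the invariant. [folklore] -/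
theorem runD_sound (hT : TableOK T tmax) {U fuel : ℕ} {d d' : SD} (hI : Inv T X d)
    (h : runD T X U fuel d = some d') : Inv T X d' := by
  unfold runD at h
  rcases he : expand T d with _ | s
  · rw [he] at h; simp at h
  · rw [he] at h
    simp only [Option.map_eq_some_iff] at h
    obtain ⟨s', hs', rfl⟩ := h
    obtain ⟨hW, hc⟩ := expand_spec hT he
    rw [← hc] at hI
    exact (run_sound hT fuel hW hI hs').2

/-! ### The initial state -/

/-- **Soundness of `upOK`**: the ratio of the threshold `x` of level `j` is `≥ 1` at `ε = e/2⁸⁰`.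
[folklore] -/
theorem upOK_sound {e j x : ℕ} (h : upOK e j x = true) (hx : 2 ≤ x) (hj : 1 ≤ j) :
    1 ≤ ratioF ((e : ℝ) / 2 ^ 80) (x : ℝ) (j - 1) := by
  unfold upOK at h
  rcases hl : logN x with _ | ⟨Blo, Bhi⟩
  · rw [hl] at h; simp at h
  · rw [hl] at h
    simp only [Nat.mul_eq, Nat.sub_eq] at h
    obtain ⟨-, hB2, -⟩ := logN_sound hl
    set q := x * gsum x (j - 1) with hq
    cases hg : Nat.blt q 2 with
    | true => rw [hg] at h; simp at h
    | false =>
      rw [hg] at h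
      simp only [cond_false] at h
      have hq2 : ¬ q < 2 := blt_false hg
      have hqpos : 0 < q := by omega
      rcases hA : lnp 1 q with ⟨Alo, Ahi⟩
      rw [hA] at h
      simp only at h
      have hN : e * Bhi ≤ Alo * SC := ble_true h
      obtain ⟨hA1, -⟩ := lnp_sound (p := 1) hqpos (by omega)
      rw [hA] at hA1
      simp only at hA1
      have hAreal : Real.log (1 + ((1 : ℕ) : ℝ) / q) = Areal x j := by
        unfold Areal; rw [hq]; push_cast; ring_nf
      rw [hAreal] at hA1
      have hx1 : 1 ≤ x := le_trans (by norm_num) hx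
      have hxR : (1 : ℝ) ≤ x := by exact_mod_cast hx1
      have hpos := ratioF_pos' ((e : ℝ) / 2 ^ 80) hxR (j - 1)
      rw [← Real.log_nonneg_iff hpos, log_ratioF_eq _ hx1 hj]
      have hNR : (e : ℝ) * Bhi ≤ (Alo : ℝ) * 2 ^ 80 := by rw [← SC_real]; exact_mod_cast hN
      have he0 : (0 : ℝ) ≤ e := by positivity
      have h3 : (e : ℝ) * (2 ^ 80 * Real.log x) ≤ e * Bhi := mul_le_mul_of_nonneg_left hB2 he0
      have h5 : 2 ^ 80 * (e * Real.log x) ≤ 2 ^ 80 * (2 ^ 80 * Areal x j) := by nlinarith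
      have h6 : (e : ℝ) * Real.log x ≤ 2 ^ 80 * Areal x j := le_of_mul_le_mul_left h5 (by positivity)
      have : (e : ℝ) / 2 ^ 80 * Real.log x ≤ Areal x j := by
        rw [div_mul_eq_mul_div, div_le_iff₀ (by positivity)]; linarith
      linarith

/-- The product over a part of the table with zero exponents is `1`. [folklore] -/
theorem prod_map_pow_expo_eq_one {xs : List ℕ} {tt : List ℕ} (h : ∀ q ∈ tt, expo xs q = 0) :
    (tt.map fun q => q ^ expo xs q).prod = 1 := by
  induction tt with
  | nil => simp
  | cons a t ih =>
    simp only [List.map_cons, List.prod_cons]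
    rw [h a (by simp), pow_zero, one_mul]
    exact ih fun q hq => h q (List.mem_cons_of_mem _ hq)

/-- A sum over a part of the table with zero exponents vanishes (for `S`). [folklore] -/
theorem sum_map_S_eq_zero {xs : List ℕ} {tt : List ℕ} (h : ∀ q ∈ tt, expo xs q = 0) :
    (tt.map fun q => Real.log (gsum q (expo xs q)) - (expo xs q : ℝ) * Real.log q).sum = 0 := by
  induction tt with
  | nil => simp
  | cons a t ih =>
    simp only [List.map_cons, List.sum_cons]
    rw [h a (by simp), ih fun q hq => h q (List.mem_cons_of_mem _ hq)]
    simp [gsum]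

/-- A sum over a part of the table above `x` vanishes (for `Θ_T`). [folklore] -/
theorem sum_map_Th_eq_zero {x : ℕ} {tt : List ℕ} (h : ∀ q ∈ tt, x < q) :
    (tt.map fun q => if q ≤ x then Real.log q else 0).sum = 0 := by
  induction tt with
  | nil => simp
  | cons a t ih =>
    simp only [List.map_cons, List.sum_cons]
    rw [if_neg (by have := h a (by simp); omega), ih fun q hq => h q (List.mem_cons_of_mem _ hq), add_zero]

/-- **The initial state satisfies the invariant** (for a table starting `2, 3, 5, 7, 11, 13, …`):
`N₀ = 55440 = 2⁴·3²·5·7·11`, `σ(N₀) = 232128`, thresholds `11, 3, 2, 2`, and Robin's inequality for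
`5040 < n ≤ 55440` from `RobinNumerical`. [folklore] -/
theorem initD_inv (hT : TableOK T tmax) {tt : List ℕ} (hTeq : T = 2 :: 3 :: 5 :: 7 :: 11 :: 13 :: tt)
    {d : SD} (h : initD = some d) : Inv T X d := by
  have hsorted := hT.sorted
  have htt : ∀ q ∈ tt, 13 < q := by
    rw [hTeq] at hsorted
    simp only [List.pairwise_cons] at hsorted
    exact hsorted.2.2.2.2.2.1
  -- unfold `initD`
  unfold initD at h
  simp only at h
  cases hg : (!(upOK 43521329506126650289422 1 11 && upOK 43521329506126650289422 2 3 &&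
      upOK 43521329506126650289422 3 2 && upOK 43521329506126650289422 4 2)) with
  | true => rw [hg] at h; simp at h
  | false =>
  rw [hg] at h
  simp only [cond_false] at h
  simp only [Bool.not_eq_false', Bool.and_eq_true] at hg
  obtain ⟨⟨⟨hu1, hu2⟩, hu3⟩, hu4⟩ := hg
  rcases h1 : logN 55440 with _ | ⟨nlo, nhi⟩
  · rw [h1] at h; simp at h
  · rw [h1] at h
    rcases h2 : logN 232128 with _ | ⟨slo, shi⟩
    · rw [h2] at h; simp at h
    · rw [h2] at h
      rcases h3 : logN 2310 with _ | ⟨tlo, thi⟩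
      · rw [h3] at h; simp at h
      · rw [h3] at h
        simp only at h
        rcases h4 : lllLoN nlo with _ | lll
        · rw [h4] at h; simp at h
        · rw [h4] at h
          simp only [Option.some.injEq] at h
          subst h
          obtain ⟨hn1, hn2, -⟩ := logN_sound h1
          obtain ⟨hs1, hs2, -⟩ := logN_sound h2
          obtain ⟨ht1, ht2, -⟩ := logN_sound h3
          -- the semantic quantities at the initial thresholds
          have hexpo : ∀ q ∈ tt, expo [11, 3, 2, 2] q = 0 := by
            intro q hq
            have := htt q hq
            simp [expo, List.filter, show ¬ q ≤ 11 by omega, show ¬ q ≤ 3 by omega, show ¬ q ≤ 2 by omega]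
          have hN : Nnat T [11, 3, 2, 2] = 55440 := by
            rw [hTeq]
            unfold Nnat
            simp only [List.map_cons, List.prod_cons]
            rw [prod_map_pow_expo_eq_one hexpo]
            simp [expo, List.filter]
          have hL : Lreal T [11, 3, 2, 2] = Real.log 55440 := by
            rw [← log_Nnat hT.two_le, hN]; norm_num
          have hS : Sreal T [11, 3, 2, 2] = Real.log 232128 - Real.log 55440 := by
            rw [hTeq]
            unfold Sreal
            simp only [List.map_cons, List.sum_cons]
            rw [sum_map_S_eq_zero hexpo]
            simp only [expo, List.filter]
            have g1 : gsum 2 4 = 31 := by decide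
            have g2 : gsum 3 2 = 13 := by decide
            have g3 : gsum 5 1 = 6 := by decide
            have g4 : gsum 7 1 = 8 := by decide
            have g5 : gsum 11 1 = 12 := by decide
            have g6 : gsum 13 0 = 1 := by decide
            norm_num [g1, g2, g3, g4, g5, g6]
            have e1 : Real.log 232128 = Real.log 31 + Real.log 13 + Real.log 6 + Real.log 8 + Real.log 12 := by
              rw [show (232128 : ℝ) = 31 * 13 * 6 * 8 * 12 by norm_num]
              repeat rw [Real.log_mul (by norm_num) (by norm_num)]
            have e2 : Real.log 55440 = 4 * Real.log 2 + 2 * Real.log 3 + Real.log 5 + Real.log 7 + Real.log 11 := by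
              rw [show (55440 : ℝ) = 2 ^ 4 * 3 ^ 2 * 5 * 7 * 11 by norm_num]
              repeat rw [Real.log_mul (by norm_num) (by norm_num)]
              rw [Real.log_pow, Real.log_pow]; push_cast; ring
            rw [e1, e2]; ring
          have hTh : ThT T 11 = Real.log 2310 := by
            rw [hTeq]
            unfold ThT
            simp only [List.map_cons, List.sum_cons]
            rw [sum_map_Th_eq_zero (x := 11) (fun q hq => by have := htt q hq; omega)]
            norm_num
            rw [show (2310 : ℝ) = 2 * 3 * 5 * 7 * 11 by norm_num]
            repeat rw [Real.log_mul (by norm_num) (by norm_num)]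
            ring
          have h13 : 13 ∈ T := by rw [hTeq]; simp
          refine ⟨by simp, by show List.Pairwise (· ≥ ·) [11, 3, 2, 2]; decide,
            by show ∀ x ∈ [11, 3, 2, 2], 2 ≤ x; decide, ?_, by norm_num, ?_, ?_, ?_, ?_, ?_, ?_, ?_, ?_⟩
          · show after 11 T ≠ []
            exact after_ne_nil hT.sorted h13 (by norm_num)
          · -- `CondUp`
            intro j hj
            simp only [List.length_cons, List.length_nil] at hj
            have h11 := upOK_sound hu1 (by norm_num) le_rfl
            have h3' := upOK_sound hu2 (by norm_num) (by norm_num)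
            have h2a := upOK_sound hu3 (by norm_num) (by norm_num)
            have h2b := upOK_sound hu4 (by norm_num) (by norm_num)
            interval_cases j
            · simpa using h11
            · simpa using h3'
            · simpa using h2a
            · simpa using h2b
          · show ((nlo : ℕ) : ℝ) ≤ 2 ^ 80 * Lreal T [11, 3, 2, 2]
            rw [hL]; exact_mod_cast hn1
          · show 2 ^ 80 * Sreal T [11, 3, 2, 2] ≤ ((Nat.sub shi nlo : ℕ) : ℝ)
            rw [hS, Nat.sub_eq]
            have hle : nlo ≤ shi := by
              have : (nlo : ℝ) ≤ shi := by
                have h55 : Real.log (55440 : ℝ) ≤ Real.log 232128 := Real.log_le_log (by norm_num) (by norm_num)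
                push_cast at hn1 hs2
                linarith
              exact_mod_cast this
            rw [Nat.cast_sub hle]
            push_cast at hn1 hs2 ⊢
            linarith
          · show ((lll : ℕ) : ℝ) ≤ 2 ^ 80 * Real.log (Real.log (Lreal T [11, 3, 2, 2]))
            rw [hL]
            apply lllLoN_sound h4
            push_cast at hn1; exact hn1
          · show 2 ^ 80 * ThT T 11 ≤ ((thi : ℕ) : ℝ)
            rw [hTh]; push_cast at ht2; exact ht2
          · intro v hv; simp at hv
          · show 55440 ≤ Nnat T [11, 3, 2, 2]
            rw [hN]
          · intro n hn5 hnN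
            rw [hN] at hnN
            exact robinInequality_le_55440 n hn5 hnN

/-! ### The conclusion -/

/-- **Robin's inequality below `X` from a finished run.** If a compact state satisfying the invariant
has frozen `ThX = v` (so `2⁸⁰ θ(p) ≤ v` for every prime `p < X`) and `Llo ≥ v + U`, and every
colossally abundant `N` with all prime factors `< X` satisfies `log N ≤ θ(P) + U/2⁸⁰` for some prime
`P < X` (the size of a colossally abundant number in terms of its largest prime,
`ColossallyAbundantExponents`), then `robinCA_below X`. [cite: Robin1984, §3 Prop. 1] -/
theorem robinCA_below_of_inv (hT : TableOK T tmax) {d : SD} (hI : Inv T X d) {v U : ℕ}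
    (hv : d.ThX = some v) (hU : v + U ≤ d.Llo)
    (hsize : ∀ N : ℕ, N.ColossallyAbundant → 5040 < N → (∀ p : ℕ, p.Prime → p ∣ N → p < X) →
      ∃ P : ℕ, P.Prime ∧ P < X ∧ Real.log N ≤ Chebyshev.theta P + (U : ℝ) / 2 ^ 80) :
    robinCA_below X := by
  intro N hCA h5040 hprimes
  obtain ⟨P, hP, hPX, hlog⟩ := hsize N hCA h5040 hprimes
  have hθ := hI.ThX_spec v hv P hP hPX
  have hUR : ((v : ℕ) : ℝ) + U ≤ d.Llo := by exact_mod_cast hU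
  have hLlo := hI.Llo_le
  have hLN : Real.log (Nnat T d.xs : ℕ) = Lreal T d.xs := log_Nnat hT.two_le d.xs
  have hN0 : (0 : ℝ) < N := by exact_mod_cast (show 0 < N by omega)
  have hNd0 : (0 : ℝ) < (Nnat T d.xs : ℕ) := by exact_mod_cast Nnat_pos hT.two_le d.xs
  have hle : Real.log N ≤ Real.log (Nnat T d.xs : ℕ) := by
    rw [hLN]
    have h1 : 2 ^ 80 * Real.log N ≤ 2 ^ 80 * Chebyshev.theta P + U := by
      have := mul_le_mul_of_nonneg_left hlog (by positivity : (0 : ℝ) ≤ 2 ^ 80)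
      rw [mul_add, mul_div_cancel₀ _ (by positivity)] at this
      exact this
    nlinarith
  have hNle : N ≤ Nnat T d.xs := by
    have := (Real.log_le_log_iff hN0 hNd0).1 hle
    exact_mod_cast this
  exact hI.robin N h5040 hNle

end RunSound

end Literature.NumberTheory.LFunctions.ChainCheck
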